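import Literature.Barriers.NavierStokesRegularity.ComplexNavierStokesBlowupSeriesProfile
import Literature.Analysis.FluidPDE.PoincareBall
import Mathlib.Analysis.SpecialFunctions.Pow.Real
import Mathlib.Analysis.SpecialFunctions.Integrals.Basic
import Mathlib.Analysis.PSeries
import HarnessLib

/-!
# Li–Sinai complex Navier–Stokes blow-up: §10 from hypotheses of the literal shape of Theorem 1 (a₁), (a₂)

A further file of the barrier entry `ComplexNavierStokesBlowup` (D-0021), companion of
`ComplexNavierStokesBlowupSeriesProfile.lean` (D. Li, Ya. G. Sinai, *Blow ups of complex
solutions of the 3D Navier–Stokes system and renormalization group method*, J. Eur. Math. Soc.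
10 (2008) 267–313: the power series (3) solves the integral equation (1) at all times —
`ComplexNavierStokesBlowupSeries.lean` —, and §10 p. 312 derives the blow-up at the critical
amplitude from Theorem 1 p. 311). Everything here is PROVED; no fact is stated (the `def`s are
Li–Sinai's rescaled variable `Y`, the thin windows and the main term of Theorem 1 (a₁), with
bodies).

## Why this file

`LiSinai.energy_eq_top_of_coeffProfile` (Profile file) formalises the first paragraph of §10 —
"`A^p g_p(k, t)` … takes values `O(p)` [on a domain of size `O(√p)`]. This immediately implies
that at `t` the energy is infinite" — under a SIGN hypothesis (S): `⟨e, g_p(k, s)⟩ ≤ 0` for ALL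
orders `p ≥ p*` at every wave vector of the union of the windows. Theorem 1 does not print that:
at the orders `p` for which `k` lies in the domain `B = {|Y| > D₁√(ln(p k⁽⁰⁾))}` of p. 303 it
prints only the UNSIGNED bound (a₂) p. 312 (`|g̃_p(Y, s)| ≤ (p k⁽⁰⁾)^{-λ₁}`), and inside the domain
of (a₁) the sign of `⟨e₁, g̃_p⟩ = p Z Λ^p e^{-|Y|²/2} (-2Y₁ + δ₁⁽ᵖ⁾)` is that of `-2Y₁` only where
`2Y₁ ≥ sup|δ₁⁽ᵖ⁾|`. This file removes the discrepancy:

* `LiSinai.energy_eq_top_of_coeffSlack`: (S) is weakened to a ONE-SIDED bound with a small slack,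
  `⟨e, g_p(k, s)⟩ ≤ C₂ p^{-γ}` (any `γ > 0`), required only at the orders present at `k`
  (`p a ≤ k₃`); the price is an upper bound `vol(Core_p) ≤ κ' p` on the cores (Li–Sinai's
  windows thinned in the vertical direction, `lsThinCore`, volume `4 k₀ p`). Bookkeeping: by the
  heat factor the window contributes `≤ C₂ p^{-γ}/|k|²` to `⟨e, mode_p(t, k)⟩⁺`; summed over the
  `≤ |k|/a + 1` orders present (all `≥ |k|/(|R|+1)`) this is `O(|k|^{-1-γ})`, square integrable
  over the union of the thin cores (`Σ_q q · q^{-2-2γ} < ∞`), which is all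
  `energy_eq_top_of_signedModes` needs.
* `LiSinai.energy_eq_top_of_mainTheoremShape`: hypotheses LITERALLY of the printed shape —
  (a₁) `‖g_p(k,s) - p Z(s) Θ(s)^p e^{-|Y|²/2} H(Y)‖ ≤ p Z(s) Θ(s)^p e^{-|Y|²/2} δ₀` for
  `|Y| ≤ D_p`, `Y = (k - K⁽ᵖ⁾)/√(p k₀)` (`rescale`), with `0 ≤ Θ(s)`, `Θ(s) ≥ 1 - L(t-s)`
  (`Θ(s) = Λ(s)/Λ(t)`, critical normalisation `A_cr(t) = Λ(t)⁻¹` absorbed into the datum;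
  "`Λ(t')/Λ(t) = 1 - BΔt + O(Δt)`", §10 p. 312), `0 < Z₀ ≤ Z(s)`, `⟨e, H(Y)⟩ ≤ -h Y₁` for
  `Y₁ ≥ 0` (`H⁽⁰⁾ = (-2Y₁, -2Y₂, 0)`, §7
  p. 295, `e = e₁`, `h = 2`), `sup|δ| ≤ δ₀` small; (a₂) `‖g_p(k,s)‖ ≤ C₂ p^{-γ}` for `|Y| > D_p`
  — on a final time window `s ∈ [t - η, t]`, plus the early smallness (U) of §10's second
  paragraph, give `E(t) = ∞`; `LiSinaiSeriesEnergyBlowup.of_mainTheoremShape` and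
  `ComplexNavierStokesBlowup.of_mainTheoremShape` conclude the fact and the barrier.

What remains unproved is thereby stated in the source's own terms: the conclusion of Theorem 1
(a₁), (a₂) for ONE admissible datum on a final time window (the printed theorem has parameters
`b(s)` depending on `s`, so even this is an extrapolation of its letter — the audited caveat of
`ComplexNavierStokesBlowupProofs.lean`), and the sub-criticality (U) of the same datum before `t`.
Theorem 1 itself (renormalisation group, computer-assisted steps §7 p. 295, §8 p. 302) is not
formalised anywhere in the tree.

## References

* D. Li, Ya. G. Sinai, J. Eur. Math. Soc. 10 (2008), 267–313, §2 p. 270 (rescaling), §7 p. 295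
  (`H⁽⁰⁾`), §8 p. 303 (domains A, B), Theorem 1 p. 311–312, §10 p. 312. [`LiSinai2008`]
-/

noncomputable section

open MeasureTheory Set Filter Topology
open scoped ENNReal InnerProductSpace RealInnerProductSpace

namespace Literature.Barriers.NavierStokesRegularity

/-- Local notation for Fourier space `ℝ³ = EuclideanSpace ℝ (Fin 3)`. -/
local notation "ℝ³" => EuclideanSpace ℝ (Fin 3)

namespace LiSinai

/-! ### Heat-factor gain on the final window and one-sided bounds with slack -/

/-- The heat factor integrates to at most `1/|k|²` on any window `[c, d]`, `d ≤ t`: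
`∫_c^d e^{-(t-s)|k|²} ds = (e^{-(t-d)|k|²} - e^{-(t-c)|k|²})/|k|² ≤ 1/|k|²` (`k ≠ 0`; for `c > d` the
left side is `≤ 0`). [folklore] -/
theorem integral_heat_le {t c d : ℝ} (hdt : d ≤ t) {k : ℝ³} (hk : 0 < ‖k‖) :
    ∫ s in c..d, Real.exp (-(t - s) * ‖k‖ ^ 2) ≤ (‖k‖ ^ 2)⁻¹ := by
  set w : ℝ := ‖k‖ ^ 2 with hw
  have hw0 : 0 < w := by positivity
  have heq : (fun s => Real.exp (-(t - s) * w)) = fun s => Real.exp (w * s + -(t * w)) := by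
    funext s; congr 1; ring
  rw [heq, intervalIntegral.integral_comp_mul_add (f := Real.exp) hw0.ne', integral_exp,
    smul_eq_mul]
  have h1 : Real.exp (w * d + -(t * w)) ≤ 1 := by
    rw [Real.exp_le_one_iff]; nlinarith
  have h2 : 0 < Real.exp (w * c + -(t * w)) := Real.exp_pos _
  calc w⁻¹ * (Real.exp (w * d + -(t * w)) - Real.exp (w * c + -(t * w))) ≤ w⁻¹ * 1 :=
        mul_le_mul_of_nonneg_left (by linarith) (inv_nonneg.2 hw0.le)
    _ = w⁻¹ := mul_one _

/-- On `[c, d]`, `c ≤ d ≤ t`, a one-sided bound `⟨e, g_p(k,s)⟩ ≤ σ` with `σ ≥ 0` gives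
`∫_c^d e^{-(t-s)|k|²}⟨e, g_p(k,s)⟩ ds ≤ σ/|k|²` (`k ≠ 0`; heat-factor gain `integral_heat_le`).
[folklore] -/
theorem integral_inner_coeff_le_of_slack {v₀ : ℝ³ → ℝ³} {a R M₀ : ℝ}
    (hv₀m : Measurable v₀) (hv₀ : ∀ k, v₀ k ≠ 0 → a ≤ k 2 ∧ ‖k‖ ≤ R) (hM₀ : ∀ k, ‖v₀ k‖ ≤ M₀)
    {t c d : ℝ} (hc0 : 0 ≤ c) (hcd : c ≤ d) (hdt : d ≤ t) (m : ℕ) {k : ℝ³} (hk : 0 < ‖k‖)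
    (e : ℝ³) {σ : ℝ} (hσ : 0 ≤ σ) (hslack : ∀ s ∈ Icc c d, ⟪e, coeff v₀ (m + 2) s k⟫ ≤ σ) :
    ∫ s in c..d, Real.exp (-(t - s) * ‖k‖ ^ 2) * ⟪e, coeff v₀ (m + 2) s k⟫ ≤ σ * (‖k‖ ^ 2)⁻¹ := by
  have ht : 0 ≤ t := hc0.trans (hcd.trans hdt)
  have hI := intervalIntegrable_inner_coeffIntegrand hv₀m hv₀ hM₀ ht m k e
    ⟨hc0, hcd.trans hdt⟩ ⟨hc0.trans hcd, hdt⟩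
  have hpt : ∀ s ∈ Icc c d,
      Real.exp (-(t - s) * ‖k‖ ^ 2) * ⟪e, coeff v₀ (m + 2) s k⟫ ≤
        σ * Real.exp (-(t - s) * ‖k‖ ^ 2) := by
    intro s hs
    rw [mul_comm σ]
    exact mul_le_mul_of_nonneg_left (hslack s hs) (Real.exp_pos _).le
  have hcont : Continuous fun s => σ * Real.exp (-(t - s) * ‖k‖ ^ 2) := by fun_prop
  calc ∫ s in c..d, Real.exp (-(t - s) * ‖k‖ ^ 2) * ⟪e, coeff v₀ (m + 2) s k⟫
      ≤ ∫ s in c..d, σ * Real.exp (-(t - s) * ‖k‖ ^ 2) :=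
        intervalIntegral.integral_mono_on hcd hI (hcont.intervalIntegrable _ _) hpt
    _ = σ * ∫ s in c..d, Real.exp (-(t - s) * ‖k‖ ^ 2) := intervalIntegral.integral_const_mul _ _
    _ ≤ σ * (‖k‖ ^ 2)⁻¹ := mul_le_mul_of_nonneg_left (integral_heat_le hdt hk) hσ

/-- **Upper bound for a term of (3) from sizes and a one-sided bound with slack**: if on `[0, b]`
(`0 ≤ b ≤ t`) `‖g_p(k,s)‖ ≤ B` and on `[b, t]` `⟨e, g_p(k,s)⟩ ≤ σ`, `σ ≥ 0`, then
`⟨e, mode v₀ p (t,k)⟩ ≤ b |e| B + σ/|k|²` (`p ≥ 2`, `k ≠ 0`). The slack version of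
`inner_mode_le_of_sign`, which is the case `σ = 0`. [folklore] -/
theorem inner_mode_le_of_slack {v₀ : ℝ³ → ℝ³} {a R M₀ : ℝ}
    (hv₀m : Measurable v₀) (hv₀ : ∀ k, v₀ k ≠ 0 → a ≤ k 2 ∧ ‖k‖ ≤ R) (hM₀ : ∀ k, ‖v₀ k‖ ≤ M₀)
    {t b : ℝ} (hb0 : 0 ≤ b) (hbt : b ≤ t) (m : ℕ) {k : ℝ³} (hk : 0 < ‖k‖) (e : ℝ³) {B σ : ℝ}
    (hσ : 0 ≤ σ) (hB : ∀ s ∈ Icc 0 b, ‖coeff v₀ (m + 2) s k‖ ≤ B)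
    (hslack : ∀ s ∈ Icc b t, ⟪e, coeff v₀ (m + 2) s k⟫ ≤ σ) :
    ⟪e, mode v₀ (m + 2) t k⟫ ≤ b * (‖e‖ * B) + σ * (‖k‖ ^ 2)⁻¹ := by
  have ht : 0 ≤ t := hb0.trans hbt
  have hI : ∀ {c d : ℝ}, c ∈ Icc 0 t → d ∈ Icc 0 t → IntervalIntegrable
      (fun s => Real.exp (-(t - s) * ‖k‖ ^ 2) * ⟪e, coeff v₀ (m + 2) s k⟫) volume c d :=
    fun hc hd => intervalIntegrable_inner_coeffIntegrand hv₀m hv₀ hM₀ ht m k e hc hd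
  rw [inner_mode_eq_integral hv₀m hv₀ hM₀ ht m k e,
    ← intervalIntegral.integral_add_adjacent_intervals (hI ⟨le_rfl, ht⟩ ⟨hb0, hbt⟩)
      (hI ⟨hb0, hbt⟩ ⟨ht, le_rfl⟩)]
  have h1 := integral_inner_coeff_le_of_bound (t := t) hb0 hbt m k e hB
  have h2 := integral_inner_coeff_le_of_slack hv₀m hv₀ hM₀ hb0 hbt le_rfl m hk e hσ hslack
  rw [sub_zero] at h1
  linarith

/-- **Upper bound for a term of (3) at the critical time, slack version of
`inner_mode_le_of_lower`**: if on `[0, b]` `‖g_p(k,s)‖ ≤ B`, on `[b, t]` `⟨e, g_p(k,s)⟩ ≤ σ`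
(`σ ≥ 0`), and on the final window `[t - δ, t] ⊆ [b, t]` with `δ|k|² ≤ 1` moreover
`⟨e, g_p(k,s)⟩ ≤ -L ≤ 0`, then `⟨e, mode v₀ p (t,k)⟩ ≤ b |e| B + σ/|k|² - δ e⁻¹ L` (`p ≥ 2`,
`k ≠ 0`). [cite: LiSinai2008, §10 p. 312] -/
theorem inner_mode_le_of_slack_lower {v₀ : ℝ³ → ℝ³} {a R M₀ : ℝ}
    (hv₀m : Measurable v₀) (hv₀ : ∀ k, v₀ k ≠ 0 → a ≤ k 2 ∧ ‖k‖ ≤ R) (hM₀ : ∀ k, ‖v₀ k‖ ≤ M₀)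
    {t b δ : ℝ} (hb0 : 0 ≤ b) (hδ : 0 < δ) (hbδ : b ≤ t - δ) (m : ℕ) {k : ℝ³} (hk : 0 < ‖k‖)
    (e : ℝ³) {B σ L : ℝ} (hσ : 0 ≤ σ)
    (hB : ∀ s ∈ Icc 0 b, ‖coeff v₀ (m + 2) s k‖ ≤ B)
    (hslack : ∀ s ∈ Icc b t, ⟪e, coeff v₀ (m + 2) s k⟫ ≤ σ) (hL : 0 ≤ L)
    (hlow : ∀ s ∈ Icc (t - δ) t, ⟪e, coeff v₀ (m + 2) s k⟫ ≤ -L) (hδk : δ * ‖k‖ ^ 2 ≤ 1) :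
    ⟪e, mode v₀ (m + 2) t k⟫ ≤ b * (‖e‖ * B) + σ * (‖k‖ ^ 2)⁻¹ - δ * (Real.exp (-1) * L) := by
  have hδt' : t - δ ≤ t := by linarith
  have hbt : b ≤ t := hbδ.trans hδt'
  have ht : 0 ≤ t := hb0.trans hbt
  have htδ0 : 0 ≤ t - δ := hb0.trans hbδ
  have hI : ∀ {c d : ℝ}, c ∈ Icc 0 t → d ∈ Icc 0 t → IntervalIntegrable
      (fun s => Real.exp (-(t - s) * ‖k‖ ^ 2) * ⟪e, coeff v₀ (m + 2) s k⟫) volume c d :=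
    fun hc hd => intervalIntegrable_inner_coeffIntegrand hv₀m hv₀ hM₀ ht m k e hc hd
  rw [inner_mode_eq_integral hv₀m hv₀ hM₀ ht m k e,
    ← intervalIntegral.integral_add_adjacent_intervals (hI ⟨le_rfl, ht⟩ ⟨hb0, hbt⟩)
      (hI ⟨hb0, hbt⟩ ⟨ht, le_rfl⟩),
    ← intervalIntegral.integral_add_adjacent_intervals (hI ⟨hb0, hbt⟩ ⟨htδ0, hδt'⟩)
      (hI ⟨htδ0, hδt'⟩ ⟨ht, le_rfl⟩)]
  have h1 := integral_inner_coeff_le_of_bound (t := t) hb0 hbt m k e hB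
  have h2 := integral_inner_coeff_le_of_slack hv₀m hv₀ hM₀ hb0 hbδ hδt' m hk e hσ
    fun s hs => hslack s ⟨hs.1, hs.2.trans hδt'⟩
  have h3 := integral_inner_coeff_le_of_lower hv₀m hv₀ hM₀ hδ (by linarith) m k e hL hlow hδk
  rw [sub_zero] at h1
  linarith

/-! ### Two elementary identities for real powers -/

/-- For a natural number `n` and a real `γ`: `n · n^{-γ} · (n²)⁻¹ = n^{-1-γ}` (both sides vanish
at `n = 0` when `γ ≠ -1`; used with `γ > 0`). [folklore] -/
theorem natCast_mul_rpow_mul_inv_sq {γ : ℝ} (hγ : 0 < γ) (n : ℕ) :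
    (n : ℝ) * (n : ℝ) ^ (-γ) * ((n : ℝ) ^ 2)⁻¹ = (n : ℝ) ^ (-1 - γ) := by
  rcases Nat.eq_zero_or_pos n with rfl | hn
  · have h1 : (-1 - γ) ≠ 0 := by linarith
    simp [Real.zero_rpow h1]
  · have hx : (0 : ℝ) < n := by exact_mod_cast hn
    have h2 : ((n : ℝ) ^ 2)⁻¹ = (n : ℝ) ^ (-2 : ℝ) := by
      rw [Real.rpow_neg hx.le, Real.rpow_two]
    rw [h2, ← Real.rpow_one (n : ℝ), ← Real.rpow_mul hx.le, ← Real.rpow_mul hx.le,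
      ← Real.rpow_add hx, ← Real.rpow_add hx, Real.rpow_one]
    congr 1
    ring

/-- For a positive real `x` and a real `γ`: `(x^{-1-γ})² · x = x^{-1-2γ}`. [folklore] -/
theorem rpow_sq_mul_self {γ x : ℝ} (hx : 0 < x) :
    (x ^ (-1 - γ)) ^ 2 * x = x ^ (-1 - 2 * γ) := by
  rw [← Real.rpow_two, ← Real.rpow_mul hx.le]
  conv_lhs => rw [← Real.rpow_one x, ← Real.rpow_mul hx.le 1, one_mul]
  rw [← Real.rpow_add hx]
  congr 1
  ring

/-! ### Supports of the coefficients -/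

/-- **Supports of Li–Sinai's coefficients** (`supp g_p ⊆ C + ⋯ + C`, p. 270): if the datum vanishes
off `{a ≤ k₃, |k| ≤ R}` then `coeff v₀ p (s, ·)` vanishes off `{p a ≤ k₃, |k| ≤ p R}` (every
interaction integrand of (5)–(6) vanishes identically there, `pairIntegrand_eq_zero_of_not` and
`mode_support`). [cite: LiSinai2008, §2 p. 270] -/
theorem coeff_support {v₀ : ℝ³ → ℝ³} {a R : ℝ} (hv₀ : ∀ k, v₀ k ≠ 0 → a ≤ k 2 ∧ ‖k‖ ≤ R)
    (p : ℕ) (s : ℝ) (k : ℝ³) (h : coeff v₀ p s k ≠ 0) : (p : ℝ) * a ≤ k 2 ∧ ‖k‖ ≤ p * R := by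
  rcases p with _ | _ | m
  · simp [coeff_zero] at h
  · simp [coeff_one] at h
  · by_contra hk
    apply h
    rw [coeff_add_two]
    refine Finset.sum_eq_zero fun i _ => ?_
    have hi2 := i.2
    have hsum : ((i.1 + 1 : ℕ) : ℝ) + ((m - i.1 + 1 : ℕ) : ℝ) = ((m + 2 : ℕ) : ℝ) := by
      rw [← Nat.cast_add]; congr 1; omega
    have hk' : ¬(((i.1 + 1 : ℕ) : ℝ) * a + ((m - i.1 + 1 : ℕ) : ℝ) * a ≤ k 2 ∧
        ‖k‖ ≤ ((i.1 + 1 : ℕ) : ℝ) * R + ((m - i.1 + 1 : ℕ) : ℝ) * R) := by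
      rw [← add_mul, ← add_mul, hsum]; exact hk
    have hz := pairIntegrand_eq_zero_of_not (mode_support hv₀ (i.1 + 1))
      (mode_support hv₀ (m - i.1 + 1)) hk'
    simp [hz]

/-! ### Infinite energy at the critical time with one-sided slack at the orders present -/

/-- **Square integrability of the slack bound over the union of the cores.** For measurable cores
`Core q` (`q ≥ p* ≥ 1`) with `c₀ q ≤ |k| ≤ c₁ q` on `Core q` and `vol (Core q) ≤ κ' q`, the function
`F₂(k) = (|k|/a + 1) · A₂ |k|^{-γ}/|k|²` (`γ > 0`) — the total slack of the orders present at `k`, see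
`energy_eq_top_of_coeffSlack` — satisfies `∫_{⋃_q Core q} F₂² ≤ Σ_q κ' q · (K₁ q^{-1-γ})² =
K₁² κ' Σ_q q^{-1-2γ} < ∞`. [folklore] -/
theorem lintegral_sq_slackBound_lt_top {Core : ℕ → Set ℝ³} (hCm : ∀ p, MeasurableSet (Core p))
    {pstar : ℕ} {a c₀ c₁ κ' A₂ γ : ℝ} (hp1 : 1 ≤ pstar) (ha : 0 < a) (hc₀ : 0 < c₀) (hc₁ : 0 < c₁)
    (hκ' : 0 < κ') (hA₂ : 0 ≤ A₂) (hγ : 0 < γ)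
    (hCoreNorm : ∀ p, pstar ≤ p → ∀ k ∈ Core p, c₀ * p ≤ ‖k‖ ∧ ‖k‖ ≤ c₁ * p)
    (hCoreVol' : ∀ p, pstar ≤ p → volume (Core p) ≤ ENNReal.ofReal (κ' * p)) :
    ∫⁻ k in ⋃ q, ⋃ (_ : pstar ≤ q), Core q,
      ENNReal.ofReal ((‖k‖ / a + 1) * (A₂ * ‖k‖ ^ (-γ) * (‖k‖ ^ 2)⁻¹)) ^ 2 < ∞ := by
  set F₂ : ℝ³ → ℝ≥0∞ := fun k =>
    ENNReal.ofReal ((‖k‖ / a + 1) * (A₂ * ‖k‖ ^ (-γ) * (‖k‖ ^ 2)⁻¹)) with hF₂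
  have hq1 : ∀ {q : ℕ}, pstar ≤ q → (1 : ℝ) ≤ q := fun hq => by exact_mod_cast hp1.trans hq
  set K₁ : ℝ := (c₁ / a + 1) * (A₂ * c₀ ^ (-γ) * (c₀ ^ 2)⁻¹) with hK₁
  have hK₁0 : 0 ≤ K₁ := by positivity
  have hF₂core : ∀ q, pstar ≤ q → ∀ k ∈ Core q,
      F₂ k ≤ ENNReal.ofReal (K₁ * (q : ℝ) ^ (-1 - γ)) := by
    intro q hq k hk
    obtain ⟨hk0, hk1⟩ := hCoreNorm q hq k hk
    have hq1' : (1 : ℝ) ≤ q := hq1 hq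
    have hq0 : (0 : ℝ) < q := by linarith
    have hcq : 0 < c₀ * q := mul_pos hc₀ hq0
    refine ENNReal.ofReal_le_ofReal ?_
    have h1 : ‖k‖ / a + 1 ≤ (c₁ / a + 1) * q := by
      have : ‖k‖ / a ≤ c₁ * q / a := div_le_div_of_nonneg_right hk1 ha.le
      calc ‖k‖ / a + 1 ≤ c₁ * q / a + q := add_le_add this hq1'
        _ = (c₁ / a + 1) * q := by ring
    have h2 : ‖k‖ ^ (-γ) ≤ (c₀ * q) ^ (-γ) := Real.rpow_le_rpow_of_nonpos hcq hk0 (by linarith)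
    have h3 : (‖k‖ ^ 2)⁻¹ ≤ ((c₀ * q) ^ 2)⁻¹ :=
      inv_anti₀ (by positivity) (pow_le_pow_left₀ hcq.le hk0 2)
    have h4 : A₂ * ‖k‖ ^ (-γ) * (‖k‖ ^ 2)⁻¹ ≤ A₂ * (c₀ * q) ^ (-γ) * ((c₀ * q) ^ 2)⁻¹ :=
      mul_le_mul (mul_le_mul_of_nonneg_left h2 hA₂) h3 (by positivity) (by positivity)
    have heq : (c₁ / a + 1) * q * (A₂ * (c₀ * q) ^ (-γ) * ((c₀ * q) ^ 2)⁻¹) =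
        K₁ * (q : ℝ) ^ (-1 - γ) := by
      rw [Real.mul_rpow hc₀.le hq0.le, mul_pow, mul_inv, ← natCast_mul_rpow_mul_inv_sq hγ q, hK₁]
      ring
    calc (‖k‖ / a + 1) * (A₂ * ‖k‖ ^ (-γ) * (‖k‖ ^ 2)⁻¹)
        ≤ (c₁ / a + 1) * q * (A₂ * (c₀ * q) ^ (-γ) * ((c₀ * q) ^ 2)⁻¹) :=
          mul_le_mul h1 h4 (by positivity) (by positivity)
      _ = K₁ * (q : ℝ) ^ (-1 - γ) := heq
  have hF₂int_core : ∀ q : ℕ, ∫⁻ k in ⋃ (_ : pstar ≤ q), Core q, F₂ k ^ 2 ≤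
      ENNReal.ofReal (K₁ ^ 2 * κ' * (q : ℝ) ^ (-1 - 2 * γ)) := by
    intro q
    by_cases hq : pstar ≤ q
    · have hq0 : (0 : ℝ) < q := by linarith [hq1 hq]
      have hset : (⋃ (_ : pstar ≤ q), Core q) = Core q := by ext k; simp [hq]
      rw [hset]
      calc ∫⁻ k in Core q, F₂ k ^ 2
          ≤ ∫⁻ _ in Core q, ENNReal.ofReal (K₁ * (q : ℝ) ^ (-1 - γ)) ^ 2 :=
            setLIntegral_mono' (hCm q) fun k hk => by gcongr; exact hF₂core q hq k hk
        _ = ENNReal.ofReal (K₁ * (q : ℝ) ^ (-1 - γ)) ^ 2 * volume (Core q) :=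
            setLIntegral_const _ _
        _ ≤ ENNReal.ofReal (K₁ * (q : ℝ) ^ (-1 - γ)) ^ 2 * ENNReal.ofReal (κ' * q) :=
            mul_le_mul_right (hCoreVol' q hq) _
        _ = ENNReal.ofReal (K₁ ^ 2 * κ' * (q : ℝ) ^ (-1 - 2 * γ)) := by
            rw [← ENNReal.ofReal_pow (by positivity), ← ENNReal.ofReal_mul (by positivity)]
            congr 1
            rw [mul_pow, ← rpow_sq_mul_self (γ := γ) hq0]
            ring
    · have hset : (⋃ (_ : pstar ≤ q), Core q) = ∅ := by ext k; simp [hq]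
      rw [hset, Measure.restrict_empty, lintegral_zero_measure]
      exact bot_le
  have hsum : Summable fun q : ℕ => K₁ ^ 2 * κ' * (q : ℝ) ^ (-1 - 2 * γ) :=
    (Real.summable_nat_rpow.2 (by linarith)).mul_left _
  calc ∫⁻ k in ⋃ q, ⋃ (_ : pstar ≤ q), Core q, F₂ k ^ 2
      ≤ ∑' q : ℕ, ∫⁻ k in ⋃ (_ : pstar ≤ q), Core q, F₂ k ^ 2 := lintegral_iUnion_le _ _
    _ ≤ ∑' q : ℕ, ENNReal.ofReal (K₁ ^ 2 * κ' * (q : ℝ) ^ (-1 - 2 * γ)) :=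
        ENNReal.tsum_le_tsum hF₂int_core
    _ = ENNReal.ofReal (∑' q : ℕ, K₁ ^ 2 * κ' * (q : ℝ) ^ (-1 - 2 * γ)) :=
        (ENNReal.ofReal_tsum_of_nonneg (fun q => by positivity) hsum).symm
    _ < ∞ := ENNReal.ofReal_lt_top

/-- **The negative part of a term of (3) on its core at the critical time** (the per-order
inequality behind §10's "takes values `O(p)`", slack version). For an admissible datum, `t ≥ η > 0`,
an order `p ≥ 2` and a wave vector `k` with `c₀ p ≤ |k| ≤ c₁ p`, assume `‖g_p(k,s)‖ ≤ C ρ^p` on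
`[0, t - η]`, `⟨e, g_p(k,s)⟩ ≤ C₂ p^{-γ}` on `[t - η, t]` if the order is present at `k`
(`p a ≤ k₃`), and `⟨e, g_p(k,s)⟩ ≤ -c p` on `[t - η, t] ∩ [t - 1/|k|², t]`. If `p` is beyond the
thresholds `η⁻¹ ≤ (c₀ p)²`, `t|e|C · p ρ^p < d/2`, `2C₂/(d c₀²) ≤ p`, where `d = e⁻¹ c/(2 c₁²)`,
then `(⟨e, mode v₀ p (t, k)⟩)⁻ ≥ d/p`: by `inner_mode_le_of_slack_lower` the term is
`≤ d/(2p)` (early window) `+ d/(2p)` (slack: `C₂ p^{-γ}/|k|² ≤ C₂/(c₀² p²)`) `- 2d/p` (final window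
of length `1/|k|² ≥ 1/(c₁p)²`, heat factor `≥ e⁻¹`). The order is present at `k` because
`g_p(k, t) ≠ 0` by the lower bound (`coeff_support`). [cite: LiSinai2008, §10 p. 312] -/
theorem negPart_mode_ge_on_core {v₀ : ℝ³ → ℝ³} {a R M₀ : ℝ}
    (hv₀m : Measurable v₀) (hv₀ : ∀ k, v₀ k ≠ 0 → a ≤ k 2 ∧ ‖k‖ ≤ R) (hM₀ : ∀ k, ‖v₀ k‖ ≤ M₀)
    {t η : ℝ} (hη : 0 < η) (hηt : η ≤ t) (e k : ℝ³) {p : ℕ} (hp2 : 2 ≤ p)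
    {c c₀ c₁ C ρ C₂ γ d : ℝ} (hc : 0 < c) (hc₀ : 0 < c₀) (hc₁ : 0 < c₁)
    (hC₂ : 0 ≤ C₂) (hγ : 0 < γ) (hd : d = Real.exp (-1) * c / (2 * c₁ ^ 2))
    (hk0 : c₀ * p ≤ ‖k‖) (hk1 : ‖k‖ ≤ c₁ * p)
    (hη' : η⁻¹ ≤ (c₀ * p) ^ 2) (hBd : t * ‖e‖ * C * ((p : ℝ) * ρ ^ p) < d / 2)
    (hC₂p : 2 * C₂ / (d * c₀ ^ 2) ≤ (p : ℝ))
    (hEarly : ∀ s ∈ Icc 0 (t - η), ‖coeff v₀ p s k‖ ≤ C * ρ ^ p)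
    (hSlack : ∀ s ∈ Icc (t - η) t, (p : ℝ) * a ≤ k 2 → ⟪e, coeff v₀ p s k⟫ ≤ C₂ * (p : ℝ) ^ (-γ))
    (hLower : ∀ s ∈ Icc (t - η) t, t - (‖k‖ ^ 2)⁻¹ ≤ s → ⟪e, coeff v₀ p s k⟫ ≤ -(c * p)) :
    d / p ≤ max (-⟪e, mode v₀ p t k⟫) 0 := by
  have htη : 0 ≤ t - η := sub_nonneg.2 hηt
  have hd0 : 0 < d := by rw [hd]; positivity
  have h1p : 1 ≤ p := le_trans (by norm_num) hp2
  have hp1 : (1 : ℝ) ≤ p := by exact_mod_cast h1p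
  have hp0 : (0 : ℝ) < p := by linarith
  have hkpos : 0 < ‖k‖ := lt_of_lt_of_le (by positivity) hk0
  have hw : 0 < ‖k‖ ^ 2 := by positivity
  have hCρ : 0 ≤ C * ρ ^ p := (norm_nonneg _).trans (hEarly 0 ⟨le_rfl, htη⟩)
  set δ : ℝ := (‖k‖ ^ 2)⁻¹ with hδ
  have hδ0 : 0 < δ := inv_pos.2 hw
  have hδk : δ * ‖k‖ ^ 2 ≤ 1 := by rw [hδ, inv_mul_cancel₀ hw.ne']
  have hδη : δ ≤ η := by
    have h1 : (c₀ * p) ^ 2 ≤ ‖k‖ ^ 2 := pow_le_pow_left₀ (by positivity) hk0 2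
    rw [hδ]
    exact inv_le_of_inv_le₀ hη (hη'.trans h1)
  have hδ1 : ((c₁ * p) ^ 2)⁻¹ ≤ δ := by
    rw [hδ]
    exact inv_anti₀ hw (pow_le_pow_left₀ (norm_nonneg _) hk1 2)
  have hδ2 : δ ≤ ((c₀ * p) ^ 2)⁻¹ := by
    rw [hδ]
    exact inv_anti₀ (by positivity) (pow_le_pow_left₀ (by positivity) hk0 2)
  obtain ⟨m, rfl⟩ : ∃ m, p = m + 2 := ⟨p - 2, by omega⟩
  -- the order is present on its core: the coefficient is nonzero there at time `t`
  have hlow_t := hLower t ⟨by linarith, le_rfl⟩ (by linarith)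
  have hne : coeff v₀ (m + 2) t k ≠ 0 := by
    intro h0
    rw [h0, inner_zero_right] at hlow_t
    have : (0 : ℝ) < c * ((m + 2 : ℕ) : ℝ) := by positivity
    linarith
  have hpk : ((m + 2 : ℕ) : ℝ) * a ≤ k 2 := (coeff_support hv₀ (m + 2) t k hne).1
  have hσ : 0 ≤ C₂ * ((m + 2 : ℕ) : ℝ) ^ (-γ) := by positivity
  have hx := inner_mode_le_of_slack_lower hv₀m hv₀ hM₀ htη hδ0 (by linarith) m hkpos e hσ
    hEarly (fun s hs => hSlack s hs hpk) (by positivity : (0 : ℝ) ≤ c * ((m + 2 : ℕ) : ℝ))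
    (fun s hs => hLower s ⟨by linarith [hs.1], hs.2⟩ hs.1) hδk
  -- the budget: early `≤ d/(2p)`, slack `≤ d/(2p)`, final window `≥ 2d/p`
  have hA : (t - η) * (‖e‖ * (C * ρ ^ (m + 2))) ≤ d / 2 / ((m + 2 : ℕ) : ℝ) := by
    have h1 : (t - η) * (‖e‖ * (C * ρ ^ (m + 2))) ≤ t * (‖e‖ * (C * ρ ^ (m + 2))) :=
      mul_le_mul_of_nonneg_right (by linarith) (mul_nonneg (norm_nonneg e) hCρ)
    have h2 : t * (‖e‖ * (C * ρ ^ (m + 2))) ≤ d / 2 / ((m + 2 : ℕ) : ℝ) := by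
      rw [le_div_iff₀ hp0]
      calc t * (‖e‖ * (C * ρ ^ (m + 2))) * ((m + 2 : ℕ) : ℝ)
          = t * ‖e‖ * C * (((m + 2 : ℕ) : ℝ) * ρ ^ (m + 2)) := by ring
        _ ≤ d / 2 := hBd.le
    exact h1.trans h2
  have hS : C₂ * ((m + 2 : ℕ) : ℝ) ^ (-γ) * (‖k‖ ^ 2)⁻¹ ≤ d / 2 / ((m + 2 : ℕ) : ℝ) := by
    have hσ1 : C₂ * ((m + 2 : ℕ) : ℝ) ^ (-γ) ≤ C₂ :=
      mul_le_of_le_one_right hC₂ (Real.rpow_le_one_of_one_le_of_nonpos hp1 (by linarith))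
    have h2 : 2 * C₂ ≤ ((m + 2 : ℕ) : ℝ) * (d * c₀ ^ 2) := (div_le_iff₀ (by positivity)).1 hC₂p
    have h3 : ((m + 2 : ℕ) : ℝ) * (2 * C₂) ≤
        ((m + 2 : ℕ) : ℝ) * (((m + 2 : ℕ) : ℝ) * (d * c₀ ^ 2)) :=
      mul_le_mul_of_nonneg_left h2 hp0.le
    calc C₂ * ((m + 2 : ℕ) : ℝ) ^ (-γ) * (‖k‖ ^ 2)⁻¹ ≤ C₂ * ((c₀ * ((m + 2 : ℕ) : ℝ)) ^ 2)⁻¹ := by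
          rw [← hδ]
          exact mul_le_mul hσ1 hδ2 hδ0.le hC₂
      _ = C₂ / (c₀ * ((m + 2 : ℕ) : ℝ)) ^ 2 := (div_eq_mul_inv _ _).symm
      _ ≤ d / 2 / ((m + 2 : ℕ) : ℝ) := by
          rw [div_div, div_le_div_iff₀ (by positivity) (by positivity)]
          nlinarith [h3]
  have hL : 2 * (d / ((m + 2 : ℕ) : ℝ)) ≤ δ * (Real.exp (-1) * (c * ((m + 2 : ℕ) : ℝ))) := by
    have heq : 2 * (d / ((m + 2 : ℕ) : ℝ)) =
        ((c₁ * ((m + 2 : ℕ) : ℝ)) ^ 2)⁻¹ * (Real.exp (-1) * (c * ((m + 2 : ℕ) : ℝ))) := by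
      rw [hd]
      field_simp
    rw [heq]
    exact mul_le_mul_of_nonneg_right hδ1 (by positivity)
  have hhalf : d / 2 / ((m + 2 : ℕ) : ℝ) + d / 2 / ((m + 2 : ℕ) : ℝ) = d / ((m + 2 : ℕ) : ℝ) := by
    ring
  exact le_max_of_le_left (by linarith)

/-- **Infinite energy at the critical time, the sign hypothesis weakened to a one-sided bound with
slack** (§10 p. 312, first paragraph, from hypotheses implied by the letter of Theorem 1 (a₁), (a₂)).
Setting as in `energy_eq_top_of_coeffProfile`: admissible datum `v₀` (vanishing off
`{a ≤ k₃, |k| ≤ R}`, `a > 0`; the `t`-critical datum, amplitude absorbed), `t ≥ η > 0`, a direction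
`e`, measurable cores `Core p` (`p ≥ p* ≥ 2`) with `c₀ p ≤ |k| ≤ c₁ p` on `Core p` and NOW
`κ p ≤ vol (Core p) ≤ κ' p`. Assume, for the coefficients `g_p = coeff v₀ p` of (5)–(6):
* (early smallness) `‖g_p(k, s)‖ ≤ C ρ^p` for `s ∈ [0, t - η]`, `ρ < 1`;
* (one-sided bound with slack) `⟨e, g_p(k, s)⟩ ≤ C₂ p^{-γ}` (`γ > 0`, `C₂ ≥ 0`) for `p ≥ p*`,
  `s ∈ [t - η, t]` and `k` in a core `Core q`, `q ≥ p*`, at the orders PRESENT at `k` (`p a ≤ k₃`) —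
  this is what (a₁) (`⟨e₁, g̃_p⟩ ∝ -2Y₁ + δ₁⁽ᵖ⁾`, sign fixed where `Y₁` is bounded below) and the
  UNSIGNED bound (a₂) in the domain `B` (p. 303, p. 312) give together;
* (size) `⟨e, g_p(k, s)⟩ ≤ -c p` for `p ≥ p*`, `k ∈ Core p`, `s ∈ [t - η, t] ∩ [t - 1/|k|², t]`.
Then `∫ |seriesSolution v₀ (t, k)|² dk = ∞`. Proof: the negative parts of `x_p = ⟨e, mode v₀ p (t, ·)⟩`
are `≥ d/p` on `Core p` for `p` large (`negPart_mode_ge_on_core`), so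
`Σ_p ∫ (x_p⁻)² ≥ Σ_p (d/p)² κ p = ∞`; the positive parts on the union `G` of the cores (minus the low
modes) are `≤ t|e|Cρ^p 1_{|k| ≤ p|R|}` (early window) `+ C₂ p^{-γ}/|k|²` (final window, heat gain
`integral_heat_le`) at the `≤ |k|/a + 1` orders present, all `≥ |k|/(|R| + 1)`, whence
`Σ_p x_p⁺ ≤ F₁ + F₂` with `F₂(k) = (|k|/a + 1) C₂ (|R|+1)^γ |k|^{-γ}/|k|²`, square integrable over `G`
by `lintegral_sq_slackBound_lt_top`; conclude by `energy_eq_top_of_signedModes`.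
[cite: LiSinai2008, Thm. 1 p. 311–312 and §10 p. 312] -/
theorem energy_eq_top_of_coeffSlack {v₀ : ℝ³ → ℝ³} {a R M₀ : ℝ} (ha : 0 < a)
    (hv₀m : Measurable v₀) (hv₀ : ∀ k, v₀ k ≠ 0 → a ≤ k 2 ∧ ‖k‖ ≤ R) (hM₀ : ∀ k, ‖v₀ k‖ ≤ M₀)
    {t η : ℝ} (hη : 0 < η) (hηt : η ≤ t) (e : ℝ³)
    {Core : ℕ → Set ℝ³} (hCm : ∀ p, MeasurableSet (Core p))
    {pstar : ℕ} {c c₀ c₁ κ κ' C ρ C₂ γ : ℝ} (hp2 : 2 ≤ pstar) (hc : 0 < c) (hc₀ : 0 < c₀)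
    (hc₁ : 0 < c₁) (hκ : 0 < κ) (hρ0 : 0 ≤ ρ) (hρ1 : ρ < 1) (hC₂ : 0 ≤ C₂) (hγ : 0 < γ)
    (hCoreNorm : ∀ p, pstar ≤ p → ∀ k ∈ Core p, c₀ * p ≤ ‖k‖ ∧ ‖k‖ ≤ c₁ * p)
    (hCoreVol : ∀ p, pstar ≤ p → ENNReal.ofReal (κ * p) ≤ volume (Core p))
    (hCoreVol' : ∀ p, pstar ≤ p → volume (Core p) ≤ ENNReal.ofReal (κ' * p))
    (hEarly : ∀ p, ∀ s ∈ Icc 0 (t - η), ∀ k, ‖coeff v₀ p s k‖ ≤ C * ρ ^ p)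
    (hSlack : ∀ p, pstar ≤ p → ∀ s ∈ Icc (t - η) t, ∀ q, pstar ≤ q → ∀ k ∈ Core q,
      (p : ℝ) * a ≤ k 2 → ⟪e, coeff v₀ p s k⟫ ≤ C₂ * (p : ℝ) ^ (-γ))
    (hLower : ∀ p, pstar ≤ p → ∀ k ∈ Core p, ∀ s ∈ Icc (t - η) t, t - (‖k‖ ^ 2)⁻¹ ≤ s →
      ⟪e, coeff v₀ p s k⟫ ≤ -(c * p)) :
    ∫⁻ k, ‖seriesSolution v₀ t k‖ₑ ^ 2 = ∞ := by
  have htη : 0 ≤ t - η := sub_nonneg.2 hηt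
  have hC : 0 ≤ C := by simpa [coeff_zero] using hEarly 0 0 ⟨le_rfl, htη⟩ 0
  have hp0star : (0 : ℝ) < pstar := by
    have : 0 < pstar := lt_of_lt_of_le (by norm_num) hp2
    exact_mod_cast this
  have hp1star' : 1 ≤ pstar := le_trans (by norm_num) hp2
  have hp1star : (1 : ℝ) ≤ pstar := by exact_mod_cast hp1star'
  have hq1 : ∀ {q : ℕ}, pstar ≤ q → (1 : ℝ) ≤ q := fun hq => hp1star.trans (by exact_mod_cast hq)
  have hκ' : 0 < κ' := by
    have h := (hCoreVol pstar le_rfl).trans (hCoreVol' pstar le_rfl)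
    rw [ENNReal.ofReal_le_ofReal_iff'] at h
    have hκp : 0 < κ * pstar := mul_pos hκ hp0star
    rcases h with h | h
    · by_contra hneg
      have hκ'0 : κ' ≤ 0 := not_lt.1 hneg
      nlinarith [mul_nonpos_of_nonpos_of_nonneg hκ'0 hp0star.le]
    · exact absurd h (not_le.2 hκp)
  -- the constants
  set Bc : ℝ := t * ‖e‖ * C with hBc
  have hBc0 : 0 ≤ Bc := by
    have : 0 ≤ t := hη.le.trans hηt
    positivity
  set d : ℝ := Real.exp (-1) * c / (2 * c₁ ^ 2) with hd
  have hd0 : 0 < d := by positivity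
  set R' : ℝ := |R| + 1 with hR'
  have hR'0 : 0 < R' := by positivity
  have hRR' : |R| ≤ R' := by rw [hR']; linarith
  set A₂ : ℝ := C₂ * R' ^ γ with hA₂
  have hA₂0 : 0 ≤ A₂ := by positivity
  -- the region fed to `energy_eq_top_of_signedModes`: the union of the cores minus the low modes
  set G : Set ℝ³ := ⋃ q, ⋃ (_ : pstar ≤ q), Core q with hG
  have hGm : MeasurableSet G :=
    MeasurableSet.iUnion fun q => MeasurableSet.iUnion fun _ => hCm q
  have hmemG : ∀ {k : ℝ³}, k ∈ G → ∃ q, pstar ≤ q ∧ k ∈ Core q := fun hk => by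
    obtain ⟨q, hq, hkq⟩ := Set.mem_iUnion₂.1 hk
    exact ⟨q, hq, hkq⟩
  have hCoreG : ∀ p, pstar ≤ p → Core p ⊆ G := fun p hp k hk => Set.mem_iUnion₂.2 ⟨p, hp, hk⟩
  set G' : Set ℝ³ := G ∩ {k | (pstar : ℝ) * |R| < ‖k‖} with hG'
  have hG'm : MeasurableSet G' := hGm.inter (measurableSet_lt measurable_const measurable_norm)
  -- Step 1: upper bound of the `e`-components on the cores at the orders present, `p ≥ p*`
  have hstep1 : ∀ p, pstar ≤ p → ∀ q, pstar ≤ q → ∀ k ∈ Core q, (p : ℝ) * a ≤ k 2 →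
      ⟪e, mode v₀ p t k⟫ ≤ Bc * ρ ^ p + C₂ * (p : ℝ) ^ (-γ) * (‖k‖ ^ 2)⁻¹ := by
    intro p hp q hq k hk hpk
    have hkpos : 0 < ‖k‖ :=
      lt_of_lt_of_le (mul_pos hc₀ (by linarith [hq1 hq])) (hCoreNorm q hq k hk).1
    obtain ⟨m, rfl⟩ : ∃ m, p = m + 2 := ⟨p - 2, by omega⟩
    have hσ : 0 ≤ C₂ * ((m + 2 : ℕ) : ℝ) ^ (-γ) := by positivity
    have h := inner_mode_le_of_slack hv₀m hv₀ hM₀ htη (by linarith) m hkpos e hσ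
      (fun s hs => hEarly (m + 2) s hs k) (fun s hs => hSlack (m + 2) hp s hs q hq k hk hpk)
    have hmono : (t - η) * (‖e‖ * (C * ρ ^ (m + 2))) ≤ t * (‖e‖ * (C * ρ ^ (m + 2))) :=
      mul_le_mul_of_nonneg_right (by linarith) (by positivity)
    calc ⟪e, mode v₀ (m + 2) t k⟫
        ≤ (t - η) * (‖e‖ * (C * ρ ^ (m + 2))) +
            C₂ * ((m + 2 : ℕ) : ℝ) ^ (-γ) * (‖k‖ ^ 2)⁻¹ := h
      _ ≤ t * (‖e‖ * (C * ρ ^ (m + 2))) + C₂ * ((m + 2 : ℕ) : ℝ) ^ (-γ) * (‖k‖ ^ 2)⁻¹ := by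
          linarith
      _ = Bc * ρ ^ (m + 2) + C₂ * ((m + 2 : ℕ) : ℝ) ^ (-γ) * (‖k‖ ^ 2)⁻¹ := by rw [hBc]; ring
  -- Step 2: positive parts on `G'` are dominated by ball indicators plus the slack bound
  set cst : ℝ³ → ℝ := fun k => A₂ * ‖k‖ ^ (-γ) * (‖k‖ ^ 2)⁻¹ with hcst
  have hcst0 : ∀ k, 0 ≤ cst k := fun k => by positivity
  set N : ℝ³ → ℕ := fun k => ⌊k 2 / a⌋₊ + 1 with hN
  have hpospt : ∀ k ∈ G', ∀ p : ℕ, ENNReal.ofReal (max ⟪e, mode v₀ p t k⟫ 0) ≤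
      (Metric.closedBall (0 : ℝ³) ((p : ℝ) * |R|)).indicator
        (fun _ => ENNReal.ofReal (Bc * ρ ^ p)) k +
      ({p : ℕ | p < N k}).indicator (fun _ => ENNReal.ofReal (cst k)) p := by
    intro k hk p
    by_cases hk0 : mode v₀ p t k = 0
    · simp [hk0]
    obtain ⟨hpk, hkR⟩ := mode_support hv₀ p t k hk0
    have hkR' : ‖k‖ ≤ (p : ℝ) * |R| :=
      hkR.trans (mul_le_mul_of_nonneg_left (le_abs_self R) (by positivity))
    have hp : pstar ≤ p := by
      by_contra hlt
      have h1 : (p : ℝ) * |R| ≤ (pstar : ℝ) * |R| :=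
        mul_le_mul_of_nonneg_right (by exact_mod_cast (not_le.1 hlt).le) (abs_nonneg R)
      exact absurd (hkR'.trans h1) (not_le.2 hk.2)
    have hpN : p < N k := by
      have : p ≤ ⌊k 2 / a⌋₊ := Nat.le_floor (by rw [le_div_iff₀ ha]; exact hpk)
      show p < ⌊k 2 / a⌋₊ + 1
      omega
    obtain ⟨q, hq, hkq⟩ := hmemG hk.1
    have hkpos : 0 < ‖k‖ :=
      lt_of_lt_of_le (mul_pos hc₀ (by linarith [hq1 hq])) (hCoreNorm q hq k hkq).1
    have hx := hstep1 p hp q hq k hkq hpk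
    have hp0 : (0 : ℝ) < p := lt_of_lt_of_le hp0star (by exact_mod_cast hp)
    have hkp : ‖k‖ / R' ≤ p := by
      rw [div_le_iff₀ hR'0]
      exact hkR'.trans (mul_le_mul_of_nonneg_left hRR' hp0.le)
    have hrpow : (p : ℝ) ^ (-γ) ≤ R' ^ γ * ‖k‖ ^ (-γ) := by
      have h1 : (p : ℝ) ^ (-γ) ≤ (‖k‖ / R') ^ (-γ) :=
        Real.rpow_le_rpow_of_nonpos (div_pos hkpos hR'0) hkp (by linarith)
      rw [Real.div_rpow (norm_nonneg _) hR'0.le, Real.rpow_neg hR'0.le, div_inv_eq_mul,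
        mul_comm] at h1
      exact h1
    have hslack_le : C₂ * (p : ℝ) ^ (-γ) * (‖k‖ ^ 2)⁻¹ ≤ cst k := by
      have h1 : C₂ * (p : ℝ) ^ (-γ) ≤ C₂ * (R' ^ γ * ‖k‖ ^ (-γ)) :=
        mul_le_mul_of_nonneg_left hrpow hC₂
      calc C₂ * (p : ℝ) ^ (-γ) * (‖k‖ ^ 2)⁻¹ ≤ C₂ * (R' ^ γ * ‖k‖ ^ (-γ)) * (‖k‖ ^ 2)⁻¹ :=
            mul_le_mul_of_nonneg_right h1 (by positivity)
        _ = cst k := by rw [hcst, hA₂]; ring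
    rw [Set.indicator_of_mem (mem_closedBall_zero_iff.2 hkR'),
      Set.indicator_of_mem (show p ∈ {p : ℕ | p < N k} from hpN)]
    calc ENNReal.ofReal (max ⟪e, mode v₀ p t k⟫ 0)
        ≤ ENNReal.ofReal (Bc * ρ ^ p + cst k) :=
          ENNReal.ofReal_le_ofReal (max_le (hx.trans (add_le_add_right hslack_le _))
            (add_nonneg (by positivity) (hcst0 k)))
      _ ≤ ENNReal.ofReal (Bc * ρ ^ p) + ENNReal.ofReal (cst k) := ENNReal.ofReal_add_le
  set F₁ : ℝ³ → ℝ≥0∞ := fun k => ∑' p : ℕ, (Metric.closedBall (0 : ℝ³) ((p : ℝ) * |R|)).indicator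
      (fun _ => ENNReal.ofReal (Bc * ρ ^ p)) k with hF₁
  set F₂ : ℝ³ → ℝ≥0∞ := fun k => ENNReal.ofReal ((‖k‖ / a + 1) * cst k) with hF₂
  have hpos : ∀ k ∈ G', ∑' p, ENNReal.ofReal (max ⟪e, mode v₀ p t k⟫ 0) ≤ F₁ k + F₂ k := by
    intro k hk
    have hk2 : k 2 ≤ ‖k‖ :=
      (le_abs_self _).trans (((Real.norm_eq_abs _).symm.le).trans (PiLp.norm_apply_le k 2))
    have hfin : ∑' p : ℕ, ({p : ℕ | p < N k}).indicator (fun _ => ENNReal.ofReal (cst k)) p =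
        ∑ p ∈ Finset.range (N k), ENNReal.ofReal (cst k) := by
      rw [tsum_eq_sum (s := Finset.range (N k)) (fun p hp => ?_)]
      · exact Finset.sum_congr rfl fun p hp =>
          Set.indicator_of_mem (show p ∈ {p : ℕ | p < N k} by simpa using hp) _
      · exact Set.indicator_of_notMem (show p ∉ {p : ℕ | p < N k} by simpa using hp) _
    have hNle : ((N k : ℕ) : ℝ) ≤ ‖k‖ / a + 1 := by
      have h1 : (⌊k 2 / a⌋₊ : ℝ) ≤ ⌊‖k‖ / a⌋₊ := by
        exact_mod_cast Nat.floor_le_floor (div_le_div_of_nonneg_right hk2 ha.le)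
      have h2 : (⌊‖k‖ / a⌋₊ : ℝ) ≤ ‖k‖ / a := Nat.floor_le (by positivity)
      have h3 : ((N k : ℕ) : ℝ) = (⌊k 2 / a⌋₊ : ℝ) + 1 := by rw [hN]; push_cast; ring
      linarith
    have hsl : ∑' p : ℕ, ({p : ℕ | p < N k}).indicator (fun _ => ENNReal.ofReal (cst k)) p ≤
        F₂ k := by
      rw [hfin, Finset.sum_const, Finset.card_range, nsmul_eq_mul]
      calc ((N k : ℕ) : ℝ≥0∞) * ENNReal.ofReal (cst k)
          = ENNReal.ofReal ((N k : ℕ) : ℝ) * ENNReal.ofReal (cst k) := by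
            rw [ENNReal.ofReal_natCast]
        _ = ENNReal.ofReal (((N k : ℕ) : ℝ) * cst k) := (ENNReal.ofReal_mul (by positivity)).symm
        _ ≤ F₂ k := ENNReal.ofReal_le_ofReal (mul_le_mul_of_nonneg_right hNle (hcst0 k))
    calc ∑' p : ℕ, ENNReal.ofReal (max ⟪e, mode v₀ p t k⟫ 0)
        ≤ ∑' p : ℕ, ((Metric.closedBall (0 : ℝ³) ((p : ℝ) * |R|)).indicator
              (fun _ => ENNReal.ofReal (Bc * ρ ^ p)) k +
            ({p : ℕ | p < N k}).indicator (fun _ => ENNReal.ofReal (cst k)) p) :=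
          ENNReal.tsum_le_tsum (hpospt k hk)
      _ = F₁ k + ∑' p : ℕ, ({p : ℕ | p < N k}).indicator (fun _ => ENNReal.ofReal (cst k)) p :=
          ENNReal.tsum_add
      _ ≤ F₁ k + F₂ k := add_le_add_right hsl _
  -- Step 3: square integrability of `F₁ + F₂` over `G'`
  have hF₁m : Measurable F₁ :=
    Measurable.tsum fun p => measurable_const.indicator Metric.isClosed_closedBall.measurableSet
  have hF₁int : ∫⁻ k, F₁ k ^ 2 < ∞ := lintegral_sq_tsum_ballIndicator_lt_top hBc0 hρ0 hρ1 R
  have hF₂int : ∫⁻ k in G, F₂ k ^ 2 < ∞ :=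
    lintegral_sq_slackBound_lt_top hCm hp1star' ha hc₀ hc₁ hκ' hA₂0 hγ hCoreNorm hCoreVol'
  set F : ℝ³ → ℝ≥0∞ := fun k => F₁ k + F₂ k with hF
  have hFint : ∫⁻ k in G', F k ^ 2 < ∞ := by
    have h2F₁m : Measurable fun k => 2 * F₁ k ^ 2 := (hF₁m.pow_const 2).const_mul 2
    calc ∫⁻ k in G', F k ^ 2 ≤ ∫⁻ k in G', (2 * F₁ k ^ 2 + 2 * F₂ k ^ 2) :=
          lintegral_mono fun k =>
            Literature.Analysis.FluidPDE.PoincareBall.add_sq_le_two_mul_sq_add _ _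
      _ = (∫⁻ k in G', 2 * F₁ k ^ 2) + ∫⁻ k in G', 2 * F₂ k ^ 2 := lintegral_add_left h2F₁m _
      _ = 2 * (∫⁻ k in G', F₁ k ^ 2) + 2 * ∫⁻ k in G', F₂ k ^ 2 := by
          rw [lintegral_const_mul _ (hF₁m.pow_const 2),
            lintegral_const_mul' _ _ ENNReal.ofNat_ne_top]
      _ < ∞ := by
          refine ENNReal.add_lt_top.2
            ⟨ENNReal.mul_lt_top (by simp) ?_, ENNReal.mul_lt_top (by simp) ?_⟩
          · exact lt_of_le_of_lt (setLIntegral_le_lintegral G' _) hF₁int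
          · exact lt_of_le_of_lt (lintegral_mono_set Set.inter_subset_left) hF₂int
  -- Step 4: thresholds in `p`
  have hE1 : ∀ᶠ p : ℕ in atTop, pstar ≤ p := eventually_ge_atTop pstar
  have hlin : Tendsto (fun p : ℕ => c₀ * (p : ℝ)) atTop atTop :=
    tendsto_natCast_atTop_atTop.const_mul_atTop hc₀
  have hE2 : ∀ᶠ p : ℕ in atTop, (pstar : ℝ) * |R| < c₀ * p := hlin.eventually_gt_atTop _
  have hE3 : ∀ᶠ p : ℕ in atTop, η⁻¹ ≤ (c₀ * p) ^ 2 :=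
    ((tendsto_pow_atTop two_ne_zero).comp hlin).eventually_ge_atTop _
  have hE4 : ∀ᶠ p : ℕ in atTop, Bc * ((p : ℝ) * ρ ^ p) < d / 2 := by
    have h := (tendsto_self_mul_const_pow_of_lt_one hρ0 hρ1).const_mul Bc
    rw [mul_zero] at h
    exact (tendsto_order.1 h).2 (d / 2) (half_pos hd0)
  have hE6 : ∀ᶠ p : ℕ in atTop, 2 * C₂ / (d * c₀ ^ 2) ≤ (p : ℝ) :=
    tendsto_natCast_atTop_atTop.eventually_ge_atTop _
  obtain ⟨p₁, hp₁⟩ := eventually_atTop.1 (hE1.and (hE2.and (hE3.and (hE4.and hE6))))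
  -- Step 5: the cores lie in `G'` and the negative parts are `≥ d/p` on them, `p ≥ p₁`
  have hcoreG' : ∀ p, p₁ ≤ p → Core p ⊆ G' := by
    intro p hp k hk
    obtain ⟨hps, hR, -, -, -⟩ := hp₁ p hp
    exact ⟨hCoreG p hps hk, hR.trans_le (hCoreNorm p hps k hk).1⟩
  have hcore : ∀ p, p₁ ≤ p → ∀ k ∈ Core p, d / p ≤ max (-⟪e, mode v₀ p t k⟫) 0 := by
    intro p hp k hk
    obtain ⟨hps, -, hη', hBd, hC₂p⟩ := hp₁ p hp
    obtain ⟨hk0, hk1⟩ := hCoreNorm p hps k hk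
    exact negPart_mode_ge_on_core hv₀m hv₀ hM₀ hη hηt e k (hp2.trans hps) hc hc₀ hc₁ hC₂ hγ hd
      hk0 hk1 hη' (by rw [← hBc]; exact hBd) hC₂p (fun s hs => hEarly p s hs k)
      (fun s hs hpk => hSlack p hps s hs p hps k hk hpk) (fun s hs h => hLower p hps k hk s hs h)
  -- Step 6: divergence of `Σ_p ∫ (x_p⁻)²` over `G'` and conclusion
  have hterm : ∀ p, p₁ ≤ p → ENNReal.ofReal (d ^ 2 * κ / p) ≤
      ∫⁻ k in G', ENNReal.ofReal (max (-⟪e, mode v₀ p t k⟫) 0 ^ 2) := by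
    intro p hp
    obtain ⟨hps, -, -, -, -⟩ := hp₁ p hp
    have hp0 : (0 : ℝ) < p := by linarith [hq1 hps]
    calc ENNReal.ofReal (d ^ 2 * κ / p)
        = ENNReal.ofReal ((d / p) ^ 2) * ENNReal.ofReal (κ * p) := by
          rw [← ENNReal.ofReal_mul (sq_nonneg _)]
          congr 1
          field_simp
      _ ≤ ENNReal.ofReal ((d / p) ^ 2) * volume (Core p) := mul_le_mul_right (hCoreVol p hps) _
      _ = ∫⁻ _ in Core p, ENNReal.ofReal ((d / p) ^ 2) := (setLIntegral_const _ _).symm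
      _ ≤ ∫⁻ k in Core p, ENNReal.ofReal (max (-⟪e, mode v₀ p t k⟫) 0 ^ 2) :=
          setLIntegral_mono' (hCm p) fun k hk =>
            ENNReal.ofReal_le_ofReal (pow_le_pow_left₀ (by positivity) (hcore p hp k hk) 2)
      _ ≤ ∫⁻ k in G', ENNReal.ofReal (max (-⟪e, mode v₀ p t k⟫) 0 ^ 2) :=
          lintegral_mono_set (hcoreG' p hp)
  have hharm : ∑' i : ℕ, ENNReal.ofReal (d ^ 2 * κ / ((i + p₁ : ℕ) : ℝ)) = ∞ := by
    by_contra hne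
    have hne' : ∑' i : ℕ,
        ((Real.toNNReal (d ^ 2 * κ / ((i + p₁ : ℕ) : ℝ)) : NNReal) : ℝ≥0∞) ≠ ∞ := hne
    have hs : Summable fun i : ℕ => d ^ 2 * κ / ((i + p₁ : ℕ) : ℝ) :=
      (NNReal.summable_coe.2 (ENNReal.tsum_coe_ne_top_iff_summable.1 hne')).congr
        fun i => Real.coe_toNNReal _ (by positivity)
    have hdk : d ^ 2 * κ ≠ 0 := by positivity
    have hs' : Summable fun i : ℕ => ((i + p₁ : ℕ) : ℝ)⁻¹ := by
      refine (hs.div_const (d ^ 2 * κ)).congr fun i => ?_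
      rw [div_right_comm, div_self hdk, one_div]
    exact Real.not_summable_natCast_inv
      ((summable_nat_add_iff (f := fun n : ℕ => ((n : ℕ) : ℝ)⁻¹) p₁).1 hs')
  have hneg : ∑' p, ∫⁻ k in G', ENNReal.ofReal (max (-⟪e, mode v₀ p t k⟫) 0 ^ 2) = ∞ := by
    rw [← Summable.sum_add_tsum_nat_add' (M := ℝ≥0∞)
      (f := fun p => ∫⁻ k in G', ENNReal.ofReal (max (-⟪e, mode v₀ p t k⟫) 0 ^ 2)) (k := p₁)
      ENNReal.summable]
    refine top_le_iff.1 (le_add_left ?_)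
    rw [← hharm]
    exact ENNReal.tsum_le_tsum fun i => hterm (i + p₁) (Nat.le_add_left _ _)
  exact energy_eq_top_of_signedModes ha hv₀m hv₀ t e hG'm hFint hpos hneg

/-! ### Thin windows: cores of linear size and LINEAR volume -/

/-- Lower corner of the thin window of order `p`: `Y₁ ∈ [1, 2]`, `|Y₂| ≤ 1` at the `√(p k₀)` scale,
but `|k₃ - p k₀| ≤ 1` (so that the volume is linear in `p`). [cite: LiSinai2008, §2 p. 270 and
Thm. 1 (a₁) p. 311] -/
def thinCoreLo (k₀ : ℝ) (p : ℕ) : Fin 3 → ℝ :=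
  ![Real.sqrt (p * k₀), -Real.sqrt (p * k₀), p * k₀ - 1]

/-- Upper corner of the thin window of order `p` (see `thinCoreLo`). [cite: LiSinai2008, §2 p. 270
and Thm. 1 (a₁) p. 311] -/
def thinCoreHi (k₀ : ℝ) (p : ℕ) : Fin 3 → ℝ :=
  ![2 * Real.sqrt (p * k₀), Real.sqrt (p * k₀), p * k₀ + 1]

/-- **Thin window of order `p`**: the box `√(p k₀)[1, 2] × √(p k₀)[-1, 1] × (p k₀ + [-1, 1])`, a
vertical slab of Li–Sinai's window `lsCore k₀ p` (`|Y₁| ∈ [1,2]`, `|Y₂| ≤ 1`, `|Y₃| ≤ 1/√(p k₀)` in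
the rescaled variable of p. 270), of volume `4 k₀ p` — linear in `p`, as `energy_eq_top_of_coeffSlack`
requires. [cite: LiSinai2008, §2 p. 270, Thm. 1 (a₁) p. 311, §10 p. 312] -/
def lsThinCore (k₀ : ℝ) (p : ℕ) : Set ℝ³ :=
  (WithLp.ofLp : ℝ³ → (Fin 3 → ℝ)) ⁻¹' Set.Icc (thinCoreLo k₀ p) (thinCoreHi k₀ p)

/-- The thin windows are measurable (closed boxes). [folklore] -/
theorem measurableSet_lsThinCore (k₀ : ℝ) (p : ℕ) : MeasurableSet (lsThinCore k₀ p) :=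
  measurableSet_Icc.preimage (WithLp.measurable_ofLp 2 (Fin 3 → ℝ))

/-- Coordinates of a point of the thin window of order `p` (`x = p k₀`):
`√x ≤ k₁ ≤ 2√x`, `|k₂| ≤ √x`, `|k₃ - x| ≤ 1`. [folklore] -/
theorem mem_lsThinCore_iff (k₀ : ℝ) (p : ℕ) (k : ℝ³) :
    k ∈ lsThinCore k₀ p ↔
      (Real.sqrt (p * k₀) ≤ k 0 ∧ k 0 ≤ 2 * Real.sqrt (p * k₀)) ∧
      (-Real.sqrt (p * k₀) ≤ k 1 ∧ k 1 ≤ Real.sqrt (p * k₀)) ∧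
      (p * k₀ - 1 ≤ k 2 ∧ k 2 ≤ p * k₀ + 1) := by
  simp only [lsThinCore, Set.mem_preimage, Set.mem_Icc, Pi.le_def]
  constructor
  · rintro ⟨hlo, hhi⟩
    have a0 := hlo 0
    have a1 := hlo 1
    have a2 := hlo 2
    have b0 := hhi 0
    have b1 := hhi 1
    have b2 := hhi 2
    simp only [thinCoreLo, thinCoreHi, Matrix.cons_val_zero, Matrix.cons_val_one,
      Matrix.cons_val_two, Matrix.head_cons, Matrix.tail_cons] at a0 a1 a2 b0 b1 b2
    exact ⟨⟨a0, b0⟩, ⟨a1, b1⟩, ⟨a2, b2⟩⟩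
  · rintro ⟨⟨a0, b0⟩, ⟨a1, b1⟩, ⟨a2, b2⟩⟩
    refine ⟨fun i => ?_, fun i => ?_⟩
    · fin_cases i
      · simpa [thinCoreLo] using a0
      · simpa [thinCoreLo] using a1
      · simpa [thinCoreLo, Matrix.cons_val_two, Matrix.head_cons, Matrix.tail_cons] using a2
    · fin_cases i
      · simpa [thinCoreHi] using b0
      · simpa [thinCoreHi] using b1
      · simpa [thinCoreHi, Matrix.cons_val_two, Matrix.head_cons, Matrix.tail_cons] using b2

/-- **Volume of the thin window**: `vol (lsThinCore k₀ p) = 4 p k₀` (`p k₀ ≥ 0`; sides `√x, 2√x, 2`,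
`x = p k₀`). [folklore] -/
theorem volume_lsThinCore {k₀ : ℝ} {p : ℕ} (hx : 0 ≤ (p : ℝ) * k₀) :
    volume (lsThinCore k₀ p) = ENNReal.ofReal (4 * ((p : ℝ) * k₀)) := by
  rw [lsThinCore, (PiLp.volume_preserving_ofLp (Fin 3)).measure_preimage
    measurableSet_Icc.nullMeasurableSet, Real.volume_Icc_pi, Fin.prod_univ_three]
  simp only [thinCoreLo, thinCoreHi, Matrix.cons_val_zero, Matrix.cons_val_one, Matrix.cons_val_two,
    Matrix.head_cons, Matrix.tail_cons]
  set r : ℝ := Real.sqrt ((p : ℝ) * k₀) with hr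
  have hr0 : 0 ≤ r := Real.sqrt_nonneg _
  have h1 : 2 * r - r = r := by ring
  have h2 : r - -r = 2 * r := by ring
  have h3 : (p : ℝ) * k₀ + 1 - ((p : ℝ) * k₀ - 1) = 2 := by ring
  rw [h1, h2, h3, ← ENNReal.ofReal_mul hr0, ← ENNReal.ofReal_mul (by positivity)]
  congr 1
  have hrr : r * r = (p : ℝ) * k₀ := by rw [hr]; exact Real.mul_self_sqrt hx
  calc r * (2 * r) * 2 = 4 * (r * r) := by ring
    _ = 4 * ((p : ℝ) * k₀) := by rw [hrr]

/-- **The thin windows have linear size**: for `k ∈ lsThinCore k₀ p` with `k₀ > 0`, `p ≥ 1` and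
`p k₀ ≥ 2`, `(k₀/2) p ≤ |k| ≤ (k₀ + 3√k₀ + 1) p`. [folklore] -/
theorem norm_bounds_of_mem_lsThinCore {k₀ : ℝ} (hk₀ : 0 < k₀) {p : ℕ} (hp : 1 ≤ p)
    (hp2 : 2 ≤ (p : ℝ) * k₀) {k : ℝ³} (hk : k ∈ lsThinCore k₀ p) :
    k₀ / 2 * p ≤ ‖k‖ ∧ ‖k‖ ≤ (k₀ + 3 * Real.sqrt k₀ + 1) * p := by
  have hp1 : (1 : ℝ) ≤ p := by exact_mod_cast hp
  set x : ℝ := (p : ℝ) * k₀ with hx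
  have hx0 : 0 ≤ x := by positivity
  obtain ⟨⟨h0, h0'⟩, ⟨h1, h1'⟩, ⟨h2, h2'⟩⟩ := (mem_lsThinCore_iff k₀ p k).1 hk
  set r : ℝ := Real.sqrt x with hr
  have hr0 : 0 ≤ r := Real.sqrt_nonneg _
  -- `√(p k₀) ≤ p √k₀` because `p ≥ 1`
  have hrp : r ≤ (p : ℝ) * Real.sqrt k₀ := by
    rw [hr, Real.sqrt_le_left (by positivity), mul_pow, Real.sq_sqrt hk₀.le, hx]
    nlinarith
  constructor
  · have h3 : k₀ / 2 * p ≤ k 2 := by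
      have : x - 1 ≤ k 2 := h2
      have hx2 : k₀ / 2 * p = x - x / 2 := by rw [hx]; ring
      linarith
    calc k₀ / 2 * p ≤ k 2 := h3
      _ ≤ |k 2| := le_abs_self _
      _ = ‖k 2‖ := (Real.norm_eq_abs _).symm
      _ ≤ ‖k‖ := PiLp.norm_apply_le k 2
  · have hsum : ‖k‖ ≤ |k 0| + |k 1| + |k 2| := by
      rw [EuclideanSpace.norm_eq, Fin.sum_univ_three, Real.norm_eq_abs, Real.norm_eq_abs,
        Real.norm_eq_abs, Real.sqrt_le_left (by positivity)]
      nlinarith [abs_nonneg (k 0), abs_nonneg (k 1), abs_nonneg (k 2), sq_abs (k 0),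
        sq_abs (k 1), sq_abs (k 2)]
    have ha0 : |k 0| ≤ 2 * r := abs_le.2 ⟨by linarith, h0'⟩
    have ha1 : |k 1| ≤ r := abs_le.2 ⟨h1, h1'⟩
    have ha2 : |k 2| ≤ x + 1 := abs_le.2 ⟨by linarith, h2'⟩
    calc ‖k‖ ≤ |k 0| + |k 1| + |k 2| := hsum
      _ ≤ 2 * r + r + (x + 1) := by linarith
      _ = x + 3 * r + 1 := by ring
      _ ≤ x + 3 * ((p : ℝ) * Real.sqrt k₀) + p := by linarith
      _ = (k₀ + 3 * Real.sqrt k₀ + 1) * p := by rw [hx]; ring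

/-! ### Li–Sinai's rescaled variable and the main term of Theorem 1 (a₁) -/

/-- **Li–Sinai's rescaled variable** `Y = (k - K⁽ᵖ⁾)/√(p k⁽⁰⁾)`, `K⁽ᵖ⁾ = (0, 0, p k⁽⁰⁾)`, in which
the coefficient `g_p` is concentrated on `|Y| = O(1)` (p. 270: "`k = K⁽ʳ⁾ + √(r k⁽⁰⁾) Y` … the new
variable `Y` which typically will take values `O(1)`"; `g̃_p(Y, s) = g_p(K⁽ᵖ⁾ + √(pk⁽⁰⁾) Y, s)`).
[cite: LiSinai2008, §2 p. 270] -/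
def rescale (k₀ : ℝ) (p : ℕ) (k : ℝ³) : ℝ³ :=
  (Real.sqrt (p * k₀))⁻¹ • (k - ((p : ℝ) * k₀) • EuclideanSpace.single (2 : Fin 3) (1 : ℝ))

/-- First rescaled coordinate: `Y₁ = k₁/√(p k₀)`. [cite: LiSinai2008, §2 p. 270] -/
theorem rescale_apply_zero (k₀ : ℝ) (p : ℕ) (k : ℝ³) :
    rescale k₀ p k 0 = k 0 / Real.sqrt (p * k₀) := by
  simp [rescale, div_eq_inv_mul]

/-- Second rescaled coordinate: `Y₂ = k₂/√(p k₀)`. [cite: LiSinai2008, §2 p. 270] -/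
theorem rescale_apply_one (k₀ : ℝ) (p : ℕ) (k : ℝ³) :
    rescale k₀ p k 1 = k 1 / Real.sqrt (p * k₀) := by
  simp [rescale, div_eq_inv_mul]

/-- Third rescaled coordinate: `Y₃ = (k₃ - p k₀)/√(p k₀)`. [cite: LiSinai2008, §2 p. 270] -/
theorem rescale_apply_two (k₀ : ℝ) (p : ℕ) (k : ℝ³) :
    rescale k₀ p k 2 = (k 2 - p * k₀) / Real.sqrt (p * k₀) := by
  simp [rescale, div_eq_inv_mul]

/-- **On the thin window the rescaled variable is `O(1)` with `Y₁ ≥ 1`**: for `k ∈ lsThinCore k₀ p`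
with `p k₀ ≥ 1`, `1 ≤ Y₁` and `|Y|² ≤ 6` (`Y₁ ≤ 2`, `|Y₂| ≤ 1`, `|Y₃| ≤ 1/√(p k₀) ≤ 1`). [folklore] -/
theorem rescale_bounds_of_mem_lsThinCore {k₀ : ℝ} {p : ℕ} (hx1 : 1 ≤ (p : ℝ) * k₀) {k : ℝ³}
    (hk : k ∈ lsThinCore k₀ p) : 1 ≤ rescale k₀ p k 0 ∧ ‖rescale k₀ p k‖ ^ 2 ≤ 6 := by
  set x : ℝ := (p : ℝ) * k₀ with hx
  have hx0 : 0 < x := by linarith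
  obtain ⟨⟨h0, h0'⟩, ⟨h1, h1'⟩, ⟨h2, h2'⟩⟩ := (mem_lsThinCore_iff k₀ p k).1 hk
  set r : ℝ := Real.sqrt x with hr
  have hr1 : 1 ≤ r := by rw [hr, Real.le_sqrt' one_pos]; simpa using hx1
  have hr0 : 0 < r := by linarith
  have hY0 : rescale k₀ p k 0 = k 0 / r := rescale_apply_zero k₀ p k
  have hY1 : rescale k₀ p k 1 = k 1 / r := rescale_apply_one k₀ p k
  have hY2 : rescale k₀ p k 2 = (k 2 - x) / r := rescale_apply_two k₀ p k
  have hb0 : 1 ≤ k 0 / r ∧ k 0 / r ≤ 2 :=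
    ⟨(one_le_div hr0).2 h0, (div_le_iff₀ hr0).2 (by linarith)⟩
  have hb1 : -1 ≤ k 1 / r ∧ k 1 / r ≤ 1 :=
    ⟨(le_div_iff₀ hr0).2 (by linarith), (div_le_iff₀ hr0).2 (by linarith)⟩
  have hb2 : -1 ≤ (k 2 - x) / r ∧ (k 2 - x) / r ≤ 1 :=
    ⟨(le_div_iff₀ hr0).2 (by linarith), (div_le_iff₀ hr0).2 (by linarith)⟩
  refine ⟨by rw [hY0]; exact hb0.1, ?_⟩
  rw [EuclideanSpace.norm_eq, Real.sq_sqrt (Finset.sum_nonneg fun i _ => by positivity),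
    Fin.sum_univ_three, Real.norm_eq_abs, Real.norm_eq_abs, Real.norm_eq_abs, sq_abs, sq_abs,
    sq_abs, hY0, hY1, hY2]
  nlinarith [hb0.1, hb0.2, hb1.1, hb1.2, hb2.1, hb2.2]

/-- **Li–Sinai's Gaussian–Hermite fixed point** `H⁽⁰⁾(Y₁, Y₂) = (-2Y₁, -2Y₂, 0)`: the fixed
point of the renormalisation group with `x₁ = x₂ = x₃ = 0` (Case 2 p. 276: `h⁽¹⁾₁₀ = h⁽²⁾₀₁ = -2`,
`h⁽¹⁾₀₁ = h⁽²⁾₁₀ = 0`; §7 p. 295: "`H₁⁽⁰⁾(Y₁, Y₂) = -2Y₁`, `H₂⁽⁰⁾(Y₁, Y₂) = -2Y₂`, which are Hermite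
polynomials of degree one", third component `0`), the profile `H` of Theorem 1 (a₁) p. 311.
[cite: LiSinai2008, §4 p. 276, §7 p. 295, Thm. 1 (a₁) p. 311] -/
def hermiteFixedPoint (Y : ℝ³) : ℝ³ :=
  WithLp.toLp 2 ![-2 * Y 0, -2 * Y 1, 0]

/-- The first component of the fixed point in the direction `e₁`: `⟨e₁, H⁽⁰⁾(Y)⟩ = -2Y₁`, so that
hypothesis `hH` of `energy_eq_top_of_mainTheoremShape` holds for `e = e₁`, `H = H⁽⁰⁾`, `h = 2`
(with equality, for every `Y`). [cite: LiSinai2008, §7 p. 295] -/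
theorem inner_single_hermiteFixedPoint (Y : ℝ³) :
    ⟪EuclideanSpace.single (0 : Fin 3) (1 : ℝ), hermiteFixedPoint Y⟫ = -(2 * Y 0) := by
  rw [EuclideanSpace.inner_single_left]
  simp [hermiteFixedPoint]

/-- Hypothesis `hH` of `energy_eq_top_of_mainTheoremShape` for Li–Sinai's own profile:
`⟨e₁, H⁽⁰⁾(Y)⟩ ≤ -(2 Y₁)`. [cite: LiSinai2008, §7 p. 295] -/
theorem inner_single_hermiteFixedPoint_le (Y : ℝ³) (_hY : 0 ≤ Y 0) :
    ⟪EuclideanSpace.single (0 : Fin 3) (1 : ℝ), hermiteFixedPoint Y⟫ ≤ -(2 * Y 0) :=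
  (inner_single_hermiteFixedPoint Y).le

/-- **The main term of Theorem 1 (a₁) at the critical normalisation**:
`p Z(s) Θ(s)^p e^{-|Y|²/2} H(Y)`, where `Θ(s) = Λ(s)/Λ(t)` (the critical amplitude `A_cr(t) = Λ(t)⁻¹`
of §10 being absorbed into the datum, `mode_smul`) and `H = H⁽⁰⁾ = (-2Y₁, -2Y₂, 0)` is the fixed point
with `x₁ = x₂ = x₃ = 0` (§7 p. 295): Theorem 1 (a₁) p. 311 reads
`A_cr^p g̃_p(Y, s) = p Z(s) Θ(s)^p e^{-|Y|²/2} (H⁽⁰⁾(Y₁, Y₂) + δ⁽ᵖ⁾(Y, s))`, `sup|δ⁽ᵖ⁾| → 0`.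
[cite: LiSinai2008, §7 p. 295 and Thm. 1 (a₁) p. 311] -/
def mainTerm (Z Θ : ℝ → ℝ) (H : ℝ³ → ℝ³) (p : ℕ) (s : ℝ) (Y : ℝ³) : ℝ³ :=
  ((p : ℝ) * Z s * Θ s ^ p * Real.exp (-‖Y‖ ^ 2 / 2)) • H Y

/-- **One-sided bound of `⟨e, g_p⟩` inside the domain of (a₁).** If
`‖g - w • H(Y)‖ ≤ w δ₀` with `w ≥ 0` and `⟨e, H(Y)⟩ ≤ -h Y₁`, then
`⟨e, g⟩ ≤ w (‖e‖ δ₀ - h Y₁)`. [folklore] -/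
theorem inner_le_of_near_mainTerm {g HY e : ℝ³} {w δ₀ h Y₁ : ℝ} (hw : 0 ≤ w)
    (herr : ‖g - w • HY‖ ≤ w * δ₀) (hH : ⟪e, HY⟫ ≤ -(h * Y₁)) :
    ⟪e, g⟫ ≤ w * (‖e‖ * δ₀ - h * Y₁) := by
  have hsplit : ⟪e, g⟫ = ⟪e, g - w • HY⟫ + w * ⟪e, HY⟫ := by
    rw [← real_inner_smul_right, ← inner_add_right, sub_add_cancel]
  have h1 : ⟪e, g - w • HY⟫ ≤ ‖e‖ * (w * δ₀) :=
    (real_inner_le_norm _ _).trans (mul_le_mul_of_nonneg_left herr (norm_nonneg _))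
  have h2 : w * ⟪e, HY⟫ ≤ w * (-(h * Y₁)) := mul_le_mul_of_nonneg_left hH hw
  rw [hsplit]
  nlinarith

/-! ### Two real-variable inequalities used in the main estimate -/

/-- The sign threshold on the thin windows: if `k₁ ≥ √(q k₀)`, `p a ≤ q (k₀ + 1)` (the order `p` is
present at height `k₃ ≤ q k₀ + 1`) and `E²(k₀ + 1) ≤ h² a`, then `E ≤ h · k₁/√(p k₀) = h Y₁`
(`Y₁² = k₁²/(p k₀) ≥ q/p ≥ a/(k₀ + 1)`). [folklore] -/
theorem le_mul_rescaled_of_sq_le {E h a k₀ p q k₁ : ℝ} (hE : 0 ≤ E) (hh : 0 < h) (hk₀ : 0 < k₀)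
    (hp : 0 < p) (hk₁ : Real.sqrt (q * k₀) ≤ k₁) (hq : 0 ≤ q) (hpa : p * a ≤ q * (k₀ + 1))
    (hδ2 : E ^ 2 * (k₀ + 1) ≤ h ^ 2 * a) : E ≤ h * (k₁ / Real.sqrt (p * k₀)) := by
  have hpx : 0 < p * k₀ := mul_pos hp hk₀
  have hk₁0 : 0 ≤ k₁ := (Real.sqrt_nonneg _).trans hk₁
  rw [← pow_le_pow_iff_left₀ hE (by positivity) two_ne_zero]
  have h1 : q * k₀ ≤ k₁ ^ 2 := by
    calc q * k₀ = Real.sqrt (q * k₀) ^ 2 := (Real.sq_sqrt (by positivity)).symm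
      _ ≤ k₁ ^ 2 := pow_le_pow_left₀ (Real.sqrt_nonneg _) hk₁ 2
  have h3 : a / (k₀ + 1) ≤ k₁ ^ 2 / (p * k₀) := by
    rw [div_le_div_iff₀ (by positivity) hpx]
    have h4 : p * a * k₀ ≤ q * (k₀ + 1) * k₀ := mul_le_mul_of_nonneg_right hpa hk₀.le
    have h5 : q * k₀ * (k₀ + 1) ≤ k₁ ^ 2 * (k₀ + 1) :=
      mul_le_mul_of_nonneg_right h1 (by positivity)
    nlinarith [h4, h5]
  have hrhs : (h * (k₁ / Real.sqrt (p * k₀))) ^ 2 = h ^ 2 * (k₁ ^ 2 / (p * k₀)) := by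
    rw [mul_pow, div_pow, Real.sq_sqrt hpx.le]
  rw [hrhs]
  calc E ^ 2 = E ^ 2 * (k₀ + 1) / (k₀ + 1) := by field_simp
    _ ≤ h ^ 2 * a / (k₀ + 1) := div_le_div_of_nonneg_right hδ2 (by positivity)
    _ = h ^ 2 * (a / (k₀ + 1)) := mul_div_assoc _ _ _
    _ ≤ h ^ 2 * (k₁ ^ 2 / (p * k₀)) := mul_le_mul_of_nonneg_left h3 (sq_nonneg _)

/-- `Θ^p ≥ 1/2` on the final window: if `0 ≤ Θ`, `Θ ≥ 1 - Lτ` with `L ≥ 0`, `τ ≤ 1/|k|²`,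
`|k| ≥ c₀ p > 0` and `p ≥ 2L/c₀²`, then `Θ^p ≥ 1 + p(Θ - 1) ≥ 1 - pL/(c₀p)² ≥ 1/2` (Bernoulli).
[folklore] -/
theorem half_le_pow_of_window {Θ L τ nk c₀ : ℝ} {p : ℕ} (hΘ0 : 0 ≤ Θ) (hΘ1 : 1 - L * τ ≤ Θ)
    (hL : 0 ≤ L) (hc₀ : 0 < c₀) (hp : 0 < (p : ℝ)) (hτ : τ ≤ (nk ^ 2)⁻¹) (hk : c₀ * p ≤ nk)
    (hpL : 2 * L / c₀ ^ 2 ≤ p) : (1 : ℝ) / 2 ≤ Θ ^ p := by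
  have h1 : (nk ^ 2)⁻¹ ≤ ((c₀ * p) ^ 2)⁻¹ :=
    inv_anti₀ (by positivity) (pow_le_pow_left₀ (by positivity) hk 2)
  have hΘ2 : 1 - L * ((c₀ * p) ^ 2)⁻¹ ≤ Θ := by
    have := mul_le_mul_of_nonneg_left (hτ.trans h1) hL
    linarith
  have hB := one_add_mul_sub_le_pow (by linarith : (-1 : ℝ) ≤ Θ) p
  have h2 : (p : ℝ) * (L * ((c₀ * p) ^ 2)⁻¹) ≤ 1 / 2 := by
    have hpL' : 2 * L ≤ (p : ℝ) * c₀ ^ 2 := (div_le_iff₀ (by positivity)).1 hpL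
    have heq : (p : ℝ) * (L * ((c₀ * p) ^ 2)⁻¹) = L / (c₀ ^ 2 * p) := by
      field_simp
    rw [heq, div_le_div_iff₀ (by positivity) (by norm_num)]
    linarith
  have h3 : -((p : ℝ) * (L * ((c₀ * p) ^ 2)⁻¹)) ≤ (p : ℝ) * (Θ - 1) := by
    have : -(L * ((c₀ * p) ^ 2)⁻¹) ≤ Θ - 1 := by linarith
    have h4 := mul_le_mul_of_nonneg_left this hp.le
    linarith
  linarith

/-! ### §10 from hypotheses of the literal shape of Theorem 1 (a₁), (a₂) -/
set_option maxHeartbeats 400000 in -- buildfix (bf3-g26): 160k/180k FAIL, 200k PASS at accept time; line-neutral budget line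
/-- **Infinite energy at the critical time from hypotheses of the printed shape of Theorem 1.**
Let `v₀` be an admissible datum (measurable, bounded, vanishing off `{a ≤ k₃, |k| ≤ R}`, `a > 0`) —
the `t`-critical datum `A_cr(t) v(k, 0)` of §10 with the amplitude absorbed — `k₀ > 0` the vertical
scale (`κ⁽⁰⁾ = (0, 0, k⁽⁰⁾)`), `t ≥ η > 0`, `p* ≥ 2` with `p* k₀ ≥ 2`, and let `Y = rescale k₀ p k`.
Data of the shape of Theorem 1 p. 311–312: a profile `H` and a direction `e` with
`⟨e, H(Y)⟩ ≤ -h Y₁` whenever `Y₁ ≥ 0` (`h > 0`; for the source `H = H⁽⁰⁾ = (-2Y₁, -2Y₂, 0)`, §7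
p. 295, `e = e₁`, `h = 2`), functions `Z(s) ≥ Z₀ > 0` and `Θ(s)` with `0 ≤ Θ(s)`,
`Θ(s) ≥ 1 - L(t - s)` on `[t - η, t]` (`Θ(s) = Λ(s)/Λ(t)` at the critical normalisation;
"`Λ(t')/Λ(t) = 1 - BΔt + O(Δt)`", §10 p. 312, `Λ` strictly increasing with `Λ' ≥ B > 0`, Thm. 1
p. 312; only the one-sided bound is used), radii `D_p ≥ √6` of the domain of (a₁), an error level
`δ₀ ≥ 0` with `‖e‖δ₀ < h` and `(‖e‖δ₀)²(k₀ + 1) ≤ h² a` (both read "`sup|δ⁽ᵖ⁾| ≤ δ₀` small", which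
is `sup_{Y,j}|δⱼ⁽ᵖ⁾(Y, s)| → 0` of (a₁) for `p ≥ p*` large; for the data (39), `a ≈ k⁽⁰⁾`). Assume
* (a₁) for `p ≥ p*`, `s ∈ [t - η, t]`, `|Y| ≤ D_p`:
  `‖g_p(k, s) - p Z(s) Θ(s)^p e^{-|Y|²/2} H(Y)‖ ≤ p Z(s) Θ(s)^p e^{-|Y|²/2} δ₀`
  (`g̃_p = p Z Λ^p e^{-|Y|²/2}(H⁽⁰⁾ + δ⁽ᵖ⁾)`, `sup|δ⁽ᵖ⁾| ≤ δ₀`, at the critical normalisation);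
* (a₂) for `p ≥ p*`, `s ∈ [t - η, t]`, `|Y| > D_p`: `‖g_p(k, s)‖ ≤ C₂ p^{-γ}`, `γ > 0` (the unsigned
  bound `(p k⁽⁰⁾)^{-λ₁}` in the domain `B`, p. 303 and p. 312);
* (U) early smallness `‖g_p(k, s)‖ ≤ C ρ^p`, `ρ < 1`, on `[0, t - η]` (§10, second paragraph).
Then `∫ |seriesSolution v₀ (t, k)|² dk = ∞`. Proof: on the thin windows `lsThinCore k₀ q` the orders
present have `Y₁² ≥ q/p ≥ a/(k₀ + 1)`, so (a₁) gives the sign `⟨e, g_p⟩ ≤ 0` there and (a₂) the slack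
`‖e‖C₂ p^{-γ}` elsewhere; on `lsThinCore k₀ p` (`1 ≤ Y₁`, `|Y|² ≤ 6 ≤ D_p²`) and
`s ≥ t - 1/|k|²`, `Θ(s)^p ≥ 1 - pL/|k|² ≥ 1/2` (Bernoulli, `|k| ≥ k₀p/2`, `p ≥ 8L/k₀²`), whence
`⟨e, g_p⟩ ≤ -p Z₀ e⁻³ (h - ‖e‖δ₀)/2`; conclude by `energy_eq_top_of_coeffSlack` (thin windows have
volume `4k₀ p`). The three displayed hypotheses are Theorem 1 of the source for ONE datum on a final
time window plus §10's sub-criticality; they are NOT proved here (renormalisation group,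
computer-assisted steps §7 p. 295, §8 p. 302; parameters `b(s)` depending on `s` in the printed
theorem — the audited caveat). [cite: LiSinai2008, Thm. 1 p. 311–312 and §10 p. 312] -/
theorem energy_eq_top_of_mainTheoremShape {v₀ : ℝ³ → ℝ³} {a R M₀ : ℝ} (ha : 0 < a)
    (hv₀m : Measurable v₀) (hv₀ : ∀ k, v₀ k ≠ 0 → a ≤ k 2 ∧ ‖k‖ ≤ R) (hM₀ : ∀ k, ‖v₀ k‖ ≤ M₀)
    {k₀ : ℝ} (hk₀ : 0 < k₀) {t η : ℝ} (hη : 0 < η) (hηt : η ≤ t)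
    (e : ℝ³) (H : ℝ³ → ℝ³) (Z Θ : ℝ → ℝ) (D : ℕ → ℝ)
    {pstar : ℕ} {h δ₀ Z₀ L C₂ γ C ρ : ℝ} (hp2 : 2 ≤ pstar) (hpk₀ : 2 ≤ (pstar : ℝ) * k₀)
    (hh : 0 < h) (hδ₀ : 0 ≤ δ₀) (hZ₀ : 0 < Z₀) (hL : 0 ≤ L) (hC₂ : 0 ≤ C₂) (hγ : 0 < γ)
    (hρ0 : 0 ≤ ρ) (hρ1 : ρ < 1)
    (hδ1 : ‖e‖ * δ₀ < h) (hδ2 : (‖e‖ * δ₀) ^ 2 * (k₀ + 1) ≤ h ^ 2 * a)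
    (hH : ∀ Y : ℝ³, 0 ≤ Y 0 → ⟪e, H Y⟫ ≤ -(h * Y 0))
    (hZ : ∀ s ∈ Icc (t - η) t, Z₀ ≤ Z s)
    (hΘ : ∀ s ∈ Icc (t - η) t, 0 ≤ Θ s ∧ 1 - L * (t - s) ≤ Θ s)
    (hD : ∀ p, pstar ≤ p → Real.sqrt 6 ≤ D p)
    (hEarly : ∀ p, ∀ s ∈ Icc 0 (t - η), ∀ k, ‖coeff v₀ p s k‖ ≤ C * ρ ^ p)
    (hA1 : ∀ p, pstar ≤ p → ∀ s ∈ Icc (t - η) t, ∀ k, ‖rescale k₀ p k‖ ≤ D p →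
      ‖coeff v₀ p s k - mainTerm Z Θ H p s (rescale k₀ p k)‖ ≤
        (p : ℝ) * Z s * Θ s ^ p * Real.exp (-‖rescale k₀ p k‖ ^ 2 / 2) * δ₀)
    (hA2 : ∀ p, pstar ≤ p → ∀ s ∈ Icc (t - η) t, ∀ k, D p < ‖rescale k₀ p k‖ →
      ‖coeff v₀ p s k‖ ≤ C₂ * (p : ℝ) ^ (-γ)) :
    ∫⁻ k, ‖seriesSolution v₀ t k‖ₑ ^ 2 = ∞ := by
  -- constants of the cores and of the lower bound
  set c₀ : ℝ := k₀ / 2 with hc₀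
  have hc₀0 : 0 < c₀ := by positivity
  set c₁ : ℝ := k₀ + 3 * Real.sqrt k₀ + 1 with hc₁
  have hc₁0 : 0 < c₁ := by positivity
  set κ : ℝ := 4 * k₀ with hκ
  have hκ0 : 0 < κ := by positivity
  set mrg : ℝ := h - ‖e‖ * δ₀ with hmrg
  have hmrg0 : 0 < mrg := by rw [hmrg]; linarith
  set c : ℝ := Z₀ * Real.exp (-3) * mrg / 2 with hc
  have hc0 : 0 < c := by positivity
  -- the threshold making `Θ(s)^p ≥ 1/2` on the final window
  set p₂ : ℕ := ⌈2 * L / c₀ ^ 2⌉₊ with hp₂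
  set pstar' : ℕ := max pstar p₂ with hpstar'
  have hps' : pstar ≤ pstar' := le_max_left _ _
  have hp2' : 2 ≤ pstar' := hp2.trans hps'
  have hpL : ∀ p, pstar' ≤ p → 2 * L / c₀ ^ 2 ≤ (p : ℝ) := fun p hp =>
    (Nat.le_ceil _).trans (by exact_mod_cast (le_max_right pstar p₂).trans hp)
  have hp1 : ∀ {p : ℕ}, pstar ≤ p → 1 ≤ p := fun hp => le_trans (by norm_num) (hp2.trans hp)
  have hx2 : ∀ {p : ℕ}, pstar ≤ p → 2 ≤ (p : ℝ) * k₀ := fun hp =>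
    hpk₀.trans (mul_le_mul_of_nonneg_right (by exact_mod_cast hp) hk₀.le)
  have hx1 : ∀ {p : ℕ}, pstar ≤ p → 1 ≤ (p : ℝ) * k₀ := fun hp => by linarith [hx2 hp]
  have hq1 : ∀ {q : ℕ}, pstar ≤ q → (1 : ℝ) ≤ q := fun hq => by exact_mod_cast hp1 hq
  -- the thin windows as cores
  have hCoreNorm : ∀ p, pstar' ≤ p → ∀ k ∈ lsThinCore k₀ p, c₀ * p ≤ ‖k‖ ∧ ‖k‖ ≤ c₁ * p :=
    fun p hp k hk => norm_bounds_of_mem_lsThinCore hk₀ (hp1 (hps'.trans hp)) (hx2 (hps'.trans hp)) hk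
  have hvol : ∀ p, pstar' ≤ p → volume (lsThinCore k₀ p) = ENNReal.ofReal (κ * p) := by
    intro p hp
    rw [volume_lsThinCore (by positivity : 0 ≤ (p : ℝ) * k₀), hκ]
    congr 1
    ring
  have hCoreVol : ∀ p, pstar' ≤ p → ENNReal.ofReal (κ * p) ≤ volume (lsThinCore k₀ p) :=
    fun p hp => (hvol p hp).symm.le
  have hCoreVol' : ∀ p, pstar' ≤ p → volume (lsThinCore k₀ p) ≤ ENNReal.ofReal (κ * p) :=
    fun p hp => (hvol p hp).le
  -- (a₁) in one direction: `⟨e, g_p⟩ ≤ w (‖e‖δ₀ - h Y₁)`, `w = p Z Θ^p e^{-|Y|²/2} ≥ 0`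
  have hA1' : ∀ p, pstar ≤ p → ∀ s ∈ Icc (t - η) t, ∀ k, ‖rescale k₀ p k‖ ≤ D p →
      0 ≤ rescale k₀ p k 0 →
      0 ≤ (p : ℝ) * Z s * Θ s ^ p * Real.exp (-‖rescale k₀ p k‖ ^ 2 / 2) ∧
      ⟪e, coeff v₀ p s k⟫ ≤ (p : ℝ) * Z s * Θ s ^ p * Real.exp (-‖rescale k₀ p k‖ ^ 2 / 2) *
        (‖e‖ * δ₀ - h * rescale k₀ p k 0) := by
    intro p hp s hs k hY hY0
    have herr := hA1 p hp s hs k hY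
    simp only [mainTerm] at herr
    have hZs : 0 ≤ Z s := hZ₀.le.trans (hZ s hs)
    have hΘs : 0 ≤ Θ s := (hΘ s hs).1
    have hw : 0 ≤ (p : ℝ) * Z s * Θ s ^ p * Real.exp (-‖rescale k₀ p k‖ ^ 2 / 2) := by
      positivity
    exact ⟨hw, inner_le_of_near_mainTerm hw herr (hH _ hY0)⟩
  -- (S'): one-sided bound with slack at the orders present on the thin windows
  have hSlack : ∀ p, pstar' ≤ p → ∀ s ∈ Icc (t - η) t, ∀ q, pstar' ≤ q → ∀ k ∈ lsThinCore k₀ q,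
      (p : ℝ) * a ≤ k 2 → ⟪e, coeff v₀ p s k⟫ ≤ (‖e‖ * C₂) * (p : ℝ) ^ (-γ) := by
    intro p hp s hs q hq k hk hpk
    have hp' : pstar ≤ p := hps'.trans hp
    have hq' : pstar ≤ q := hps'.trans hq
    by_cases hY : ‖rescale k₀ p k‖ ≤ D p
    · -- inside the domain of (a₁): the sign of `-h Y₁ + ‖e‖δ₀`, and `h Y₁ ≥ ‖e‖δ₀` there
      obtain ⟨⟨hk0lo, -⟩, -, ⟨-, hk2hi⟩⟩ := (mem_lsThinCore_iff k₀ q k).1 hk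
      have hY0 : rescale k₀ p k 0 = k 0 / Real.sqrt (p * k₀) := rescale_apply_zero k₀ p k
      have hpx : 0 < (p : ℝ) * k₀ := by linarith [hx1 hp']
      have hr : 0 < Real.sqrt (p * k₀) := Real.sqrt_pos.2 hpx
      have hk0nn : 0 ≤ k 0 := (Real.sqrt_nonneg _).trans hk0lo
      have hY0nn : 0 ≤ rescale k₀ p k 0 := by rw [hY0]; positivity
      obtain ⟨hw, hmain⟩ := hA1' p hp' s hs k hY hY0nn
      have hkey : ‖e‖ * δ₀ ≤ h * rescale k₀ p k 0 := by
        have h2 : (p : ℝ) * a ≤ q * (k₀ + 1) := by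
          have hq1' := hq1 hq'
          nlinarith [hpk, hk2hi]
        rw [hY0]
        exact le_mul_rescaled_of_sq_le (by positivity) hh hk₀ (by linarith [hq1 hp']) hk0lo
          (by positivity) h2 hδ2
      calc ⟪e, coeff v₀ p s k⟫
          ≤ (p : ℝ) * Z s * Θ s ^ p * Real.exp (-‖rescale k₀ p k‖ ^ 2 / 2) *
              (‖e‖ * δ₀ - h * rescale k₀ p k 0) := hmain
        _ ≤ 0 := mul_nonpos_of_nonneg_of_nonpos hw (by linarith)
        _ ≤ (‖e‖ * C₂) * (p : ℝ) ^ (-γ) := by positivity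
    · -- outside: the unsigned bound (a₂)
      have hlt : D p < ‖rescale k₀ p k‖ := not_le.1 hY
      calc ⟪e, coeff v₀ p s k⟫ ≤ ‖e‖ * ‖coeff v₀ p s k‖ := real_inner_le_norm _ _
        _ ≤ ‖e‖ * (C₂ * (p : ℝ) ^ (-γ)) :=
            mul_le_mul_of_nonneg_left (hA2 p hp' s hs k hlt) (norm_nonneg _)
        _ = (‖e‖ * C₂) * (p : ℝ) ^ (-γ) := by ring
  -- (L): the size `-c p` on the thin window of order `p` in the final window `[t - 1/|k|², t]`
  have hLower : ∀ p, pstar' ≤ p → ∀ k ∈ lsThinCore k₀ p, ∀ s ∈ Icc (t - η) t,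
      t - (‖k‖ ^ 2)⁻¹ ≤ s → ⟪e, coeff v₀ p s k⟫ ≤ -(c * p) := by
    intro p hp k hk s hs hsk
    have hp' : pstar ≤ p := hps'.trans hp
    have hp0 : (0 : ℝ) < p := by linarith [hq1 hp']
    obtain ⟨hY1, hY6⟩ := rescale_bounds_of_mem_lsThinCore (hx1 hp') hk
    have hYD : ‖rescale k₀ p k‖ ≤ D p := by
      have h6 : ‖rescale k₀ p k‖ ≤ Real.sqrt 6 := by
        calc ‖rescale k₀ p k‖ = Real.sqrt (‖rescale k₀ p k‖ ^ 2) := (Real.sqrt_sq (norm_nonneg _)).symm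
          _ ≤ Real.sqrt 6 := Real.sqrt_le_sqrt hY6
      exact h6.trans (hD p hp')
    obtain ⟨hw, hmain⟩ := hA1' p hp' s hs k hYD (by linarith)
    obtain ⟨hk0n, -⟩ := hCoreNorm p hp k hk
    -- `Θ(s)^p ≥ 1/2`
    have hΘp : (1 : ℝ) / 2 ≤ Θ s ^ p :=
      half_le_pow_of_window (hΘ s hs).1 (hΘ s hs).2 hL hc₀0 hp0 (by linarith) hk0n (hpL p hp)
    have hexp : Real.exp (-3) ≤ Real.exp (-‖rescale k₀ p k‖ ^ 2 / 2) :=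
      Real.exp_le_exp.2 (by linarith [hY6])
    have hZs : Z₀ ≤ Z s := hZ s hs
    have hwlow : (p : ℝ) * Z₀ * (1 / 2) * Real.exp (-3) ≤
        (p : ℝ) * Z s * Θ s ^ p * Real.exp (-‖rescale k₀ p k‖ ^ 2 / 2) := by
      have hZs0 : 0 ≤ Z s := hZ₀.le.trans hZs
      refine mul_le_mul (mul_le_mul (mul_le_mul_of_nonneg_left hZs hp0.le) hΘp (by norm_num)
        (by positivity)) hexp (by positivity) ?_
      have := (hΘ s hs).1
      positivity
    calc ⟪e, coeff v₀ p s k⟫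
        ≤ (p : ℝ) * Z s * Θ s ^ p * Real.exp (-‖rescale k₀ p k‖ ^ 2 / 2) *
            (‖e‖ * δ₀ - h * rescale k₀ p k 0) := hmain
      _ ≤ (p : ℝ) * Z s * Θ s ^ p * Real.exp (-‖rescale k₀ p k‖ ^ 2 / 2) * (‖e‖ * δ₀ - h) :=
          mul_le_mul_of_nonneg_left (by nlinarith [hY1, hh]) hw
      _ = -((p : ℝ) * Z s * Θ s ^ p * Real.exp (-‖rescale k₀ p k‖ ^ 2 / 2) * mrg) := by
          rw [hmrg]; ring
      _ ≤ -((p : ℝ) * Z₀ * (1 / 2) * Real.exp (-3) * mrg) :=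
          neg_le_neg (mul_le_mul_of_nonneg_right hwlow hmrg0.le)
      _ = -(c * p) := by rw [hc]; ring
  exact energy_eq_top_of_coeffSlack ha hv₀m hv₀ hM₀ hη hηt e (fun p => measurableSet_lsThinCore k₀ p)
    hp2' hc0 hc₀0 hc₁0 hκ0 hρ0 hρ1 (by positivity : 0 ≤ ‖e‖ * C₂) hγ hCoreNorm hCoreVol hCoreVol'
    hEarly hSlack hLower

end LiSinai

open LiSinai in
/-- **The energy-profile fact from hypotheses of the printed shape of Theorem 1.** If ONE admissible
incompressible datum has coefficients `g_p = LiSinai.coeff v₀ p` satisfying, near the critical time,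
(a₁) and (a₂) of Theorem 1 p. 311–312 in the literal form of `LiSinai.energy_eq_top_of_mainTheoremShape`
(profile `p Z(s) Θ(s)^p e^{-|Y|²/2} H(Y)` up to `δ₀` in the domain `|Y| ≤ D_p`, unsigned bound
`C₂ p^{-γ}` outside), and (U) geometric bounds of ratio `< 1` on `[0, τ]` for every `τ < t` (§10,
second paragraph: "for `p ≫ O(1/Δt)` the product `A_cr Λ(t')^p` tends exponentially to zero"), then
`LiSinaiSeriesEnergyBlowup` holds (datum `v₀`, time `t`): infinite energy at `t` by
`energy_eq_top_of_mainTheoremShape`, finite energy before `t` by `exists_modeDecay_of_coeffBound` and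
`LiSinaiSeriesEnergyBlowup.of_infinite_of_modeDecay`. Neither (a₁)–(a₂) for a fixed datum on a time
window nor (U) is proved in the tree (Theorem 1: renormalisation group with computer-assisted steps,
§7 p. 295, §8 p. 302; parameters `b(s)` depending on `s`). [cite: LiSinai2008, Thm. 1 p. 311–312 and
§10 p. 312] -/
theorem LiSinaiSeriesEnergyBlowup.of_mainTheoremShape
    {v₀ : EuclideanSpace ℝ (Fin 3) → EuclideanSpace ℝ (Fin 3)} {a R M₀ : ℝ} (ha : 0 < a)
    (hv₀m : Measurable v₀) (hv₀ : ∀ k, v₀ k ≠ 0 → a ≤ k 2 ∧ ‖k‖ ≤ R) (hM₀ : ∀ k, ‖v₀ k‖ ≤ M₀)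
    (hdiv : ∀ k, ⟪v₀ k, k⟫ = 0)
    {k₀ : ℝ} (hk₀ : 0 < k₀) {t η : ℝ} (hη : 0 < η) (hηt : η ≤ t)
    (e : EuclideanSpace ℝ (Fin 3)) (H : EuclideanSpace ℝ (Fin 3) → EuclideanSpace ℝ (Fin 3))
    (Z Θ : ℝ → ℝ) (D : ℕ → ℝ)
    {pstar : ℕ} {h δ₀ Z₀ L C₂ γ : ℝ} (hp2 : 2 ≤ pstar) (hpk₀ : 2 ≤ (pstar : ℝ) * k₀)
    (hh : 0 < h) (hδ₀ : 0 ≤ δ₀) (hZ₀ : 0 < Z₀) (hL : 0 ≤ L) (hC₂ : 0 ≤ C₂) (hγ : 0 < γ)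
    (hδ1 : ‖e‖ * δ₀ < h) (hδ2 : (‖e‖ * δ₀) ^ 2 * (k₀ + 1) ≤ h ^ 2 * a)
    (hH : ∀ Y : EuclideanSpace ℝ (Fin 3), 0 ≤ Y 0 → ⟪e, H Y⟫ ≤ -(h * Y 0))
    (hZ : ∀ s ∈ Icc (t - η) t, Z₀ ≤ Z s)
    (hΘ : ∀ s ∈ Icc (t - η) t, 0 ≤ Θ s ∧ 1 - L * (t - s) ≤ Θ s)
    (hD : ∀ p, pstar ≤ p → Real.sqrt 6 ≤ D p)
    (hU : ∀ τ ∈ Ico 0 t, ∃ C ρ : ℝ, 0 ≤ ρ ∧ ρ < 1 ∧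
      ∀ p, ∀ s ∈ Icc 0 τ, ∀ k, ‖coeff v₀ p s k‖ ≤ C * ρ ^ p)
    (hA1 : ∀ p, pstar ≤ p → ∀ s ∈ Icc (t - η) t, ∀ k, ‖rescale k₀ p k‖ ≤ D p →
      ‖coeff v₀ p s k - mainTerm Z Θ H p s (rescale k₀ p k)‖ ≤
        (p : ℝ) * Z s * Θ s ^ p * Real.exp (-‖rescale k₀ p k‖ ^ 2 / 2) * δ₀)
    (hA2 : ∀ p, pstar ≤ p → ∀ s ∈ Icc (t - η) t, ∀ k, D p < ‖rescale k₀ p k‖ →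
      ‖coeff v₀ p s k‖ ≤ C₂ * (p : ℝ) ^ (-γ)) :
    LiSinaiSeriesEnergyBlowup := by
  have ht : 0 < t := hη.trans_le hηt
  obtain ⟨C, ρ, hρ0, hρ1, hEarly⟩ := hU (t - η) ⟨sub_nonneg.2 hηt, by linarith⟩
  have hinf := energy_eq_top_of_mainTheoremShape ha hv₀m hv₀ hM₀ hk₀ hη hηt e H Z Θ D hp2 hpk₀ hh
    hδ₀ hZ₀ hL hC₂ hγ hρ0 hρ1 hδ1 hδ2 hH hZ hΘ hD hEarly hA1 hA2
  refine LiSinaiSeriesEnergyBlowup.of_infinite_of_modeDecay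
    ⟨v₀, a, R, t, ha, ht, hv₀m, ⟨M₀, hM₀⟩, hv₀, hdiv, fun τ hτ => ?_, hinf⟩
  obtain ⟨C', ρ', hρ0', hρ1', hb⟩ := hU τ hτ
  exact exists_modeDecay_of_coeffBound hv₀m hv₀ hM₀ hτ.1 hρ0' hρ1' hb

open LiSinai in
/-- **The catalogued barrier from hypotheses of the printed shape of Theorem 1** (a₁), (a₂) for one
admissible incompressible datum on a final time window, plus §10's sub-criticality (U): under the
hypotheses of `LiSinaiSeriesEnergyBlowup.of_mainTheoremShape`, `ComplexNavierStokesBlowup` holds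
(via `LiSinaiSeriesEnergyBlowup.complexNavierStokesBlowup`: the series solves (1) at all times,
Fatou). With these hypotheses PROVED for Li–Sinai's 10-parameter data (39) this would be
`ComplexNavierStokesBlowup_holds`; they are the content of Theorem 1 of the source (and of the
informal second paragraph of §10) and are not proved in the tree. [cite: LiSinai2008, Thm. 1
p. 311–312 and §10 p. 312] -/
theorem ComplexNavierStokesBlowup.of_mainTheoremShape
    {v₀ : EuclideanSpace ℝ (Fin 3) → EuclideanSpace ℝ (Fin 3)} {a R M₀ : ℝ} (ha : 0 < a)
    (hv₀m : Measurable v₀) (hv₀ : ∀ k, v₀ k ≠ 0 → a ≤ k 2 ∧ ‖k‖ ≤ R) (hM₀ : ∀ k, ‖v₀ k‖ ≤ M₀)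
    (hdiv : ∀ k, ⟪v₀ k, k⟫ = 0)
    {k₀ : ℝ} (hk₀ : 0 < k₀) {t η : ℝ} (hη : 0 < η) (hηt : η ≤ t)
    (e : EuclideanSpace ℝ (Fin 3)) (H : EuclideanSpace ℝ (Fin 3) → EuclideanSpace ℝ (Fin 3))
    (Z Θ : ℝ → ℝ) (D : ℕ → ℝ)
    {pstar : ℕ} {h δ₀ Z₀ L C₂ γ : ℝ} (hp2 : 2 ≤ pstar) (hpk₀ : 2 ≤ (pstar : ℝ) * k₀)
    (hh : 0 < h) (hδ₀ : 0 ≤ δ₀) (hZ₀ : 0 < Z₀) (hL : 0 ≤ L) (hC₂ : 0 ≤ C₂) (hγ : 0 < γ)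
    (hδ1 : ‖e‖ * δ₀ < h) (hδ2 : (‖e‖ * δ₀) ^ 2 * (k₀ + 1) ≤ h ^ 2 * a)
    (hH : ∀ Y : EuclideanSpace ℝ (Fin 3), 0 ≤ Y 0 → ⟪e, H Y⟫ ≤ -(h * Y 0))
    (hZ : ∀ s ∈ Icc (t - η) t, Z₀ ≤ Z s)
    (hΘ : ∀ s ∈ Icc (t - η) t, 0 ≤ Θ s ∧ 1 - L * (t - s) ≤ Θ s)
    (hD : ∀ p, pstar ≤ p → Real.sqrt 6 ≤ D p)
    (hU : ∀ τ ∈ Ico 0 t, ∃ C ρ : ℝ, 0 ≤ ρ ∧ ρ < 1 ∧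
      ∀ p, ∀ s ∈ Icc 0 τ, ∀ k, ‖coeff v₀ p s k‖ ≤ C * ρ ^ p)
    (hA1 : ∀ p, pstar ≤ p → ∀ s ∈ Icc (t - η) t, ∀ k, ‖rescale k₀ p k‖ ≤ D p →
      ‖coeff v₀ p s k - mainTerm Z Θ H p s (rescale k₀ p k)‖ ≤
        (p : ℝ) * Z s * Θ s ^ p * Real.exp (-‖rescale k₀ p k‖ ^ 2 / 2) * δ₀)
    (hA2 : ∀ p, pstar ≤ p → ∀ s ∈ Icc (t - η) t, ∀ k, D p < ‖rescale k₀ p k‖ →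
      ‖coeff v₀ p s k‖ ≤ C₂ * (p : ℝ) ^ (-γ)) :
    ComplexNavierStokesBlowup :=
  (LiSinaiSeriesEnergyBlowup.of_mainTheoremShape ha hv₀m hv₀ hM₀ hdiv hk₀ hη hηt e H Z Θ D hp2 hpk₀
    hh hδ₀ hZ₀ hL hC₂ hγ hδ1 hδ2 hH hZ hΘ hD hU hA1 hA2).complexNavierStokesBlowup

end Literature.Barriers.NavierStokesRegularity
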